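import Literature.MathematicalPhysics.QuantumFieldTheory.Balaban1983to89.B9Eq349ConjugatedQTowerLetterLinear

/-!
# `Balaban1983to89.B9Eq3126ClosingRadiusWindowTower` — T. Bałaban, *Propagators for lattice gauge theories in a background field*, Commun. Math. Phys. **99**
# (1985) 389–434 [Balaban1985BackgroundPropagators] (3.126) p. 420, (3.15) p. 393, (3.35)–(3.37) p. 396, (3.49) p. 399 («the constants … independent of the
# field configuration» and of the step), (3.79) p. 406, Thm 3.11 p. 416, with [Balaban1985Variational] (45)–(46) p. 285: **THE CLOSING RADIUS OF THE TOWER `H₁`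
# ROW OF ROAD ΔA-CT — ONE `r₀ > 0`, CLOSED IN `(d, L, M_φ, M_φ′, a, a′, ε_s, ϱ, γ′, κ₁, M, γ, μ₁, p_K⁰)`, BELOW WHICH EVERY RADIUS WINDOW OF THE OWNER's
# `B9Eq3126H1BlockDecayTowerClosed.norm_block_H1k_le_closed` HOLDS AT EVERY HEIGHT** — the height-DEPENDENT tower `dQ` window (gen 93's product difference
# `Π_{j<n+1}(1 + √(L^d)(θ_j + e_j(r))) − Π_{j<n+1}(1 + √(L^d)θ_j)`) LINEARISED with a HEIGHT-FREE slope on print's diagonal `ηL^{n+1} = 1` and a geometric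
# bond-window profile `ε_j ≤ ε_sϱ^j` (the per-level companion distances `L^{n+1−j}η = L^{−j}` and the level windows both sum geometrically; t4-ne9-idea-1's
# L-g148-3 `B9Eq349ConjugatedQTowerLetterLinear` does the product), and the remaining windows (`hwin*`, `hβ*`, `small′`, `hwinκ`, `hρ`, `small`, `small2`)
# solved for the radius at `ℓ = ℓ′ = 1`, `β := N_βr`, `β′ := N′r`, `β_K := 8p_K⁰r`, `ρ := (6X + 9X)∕√κ₁` — the arithmetic half of this lineage's
# `∃ r₀` BEFORE `∀ n ∀ U` form of the OWNER's closed row (sequel `B9Eq3126H1BlockDecayTowerClosedRadius`), the tower twin of `B9Eq3126ClosingRadiusWindow`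

statement-level skeleton of published theorems with citation tags; proofs where landed; nothing here is a claim about the Yang–Mills mass gap

CITATION HEADER (lean-in-tree rule).  Audit cell `pub-balaban`, sub-cell `t4`, BINDER row NE9 (road ΔA-CT of the NE9 formalisation swarm, leaf prover 03
`b2b-balaban-t4-ne9-formalise-leaf-03` gen 77).  Imports BY NAME (BUILT): `B9Eq349ConjugatedQTowerLetterLinear` (`prod_one_add_mul_add_sub_prod_le_linear_of_le`,
`prod_one_add_le_exp_sum`; Mathlib through it).  Sources READ first-hand: [Balaban1985BackgroundPropagators] (`paper:balaban1985-cmp99-background-propagators`,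
journal page = PDF page + 388) p. 393 (3.15), p. 396 (3.35)–(3.37), p. 399 (3.49), p. 406 (3.79), p. 416 Thm 3.11, p. 420 (3.126); [Balaban1985Variational] p. 285
(45)–(46).  Print's constants are «O(1)» by the random walk of Sect. C; the cell's Combes–Thomas road displays its windows explicitly and this file only solves
them for the radius — every letter symbolic, nothing of print's `δ₀` valued.

WHAT IS PROVED (sorry-free; proof lane — no `def`; [folklore] real arithmetic over `Finset.range`).
* §1 `sum_half_pow_succ_le_one` (`Σ_{j<n}(1∕2)^{j+1} ≤ 1`), `sum_levelWindow_le` (`ε_j ≤ ε_sϱ^j ⟹ Σ_{j<n+1}ε_j ≤ ε_s∕(1−ϱ)`), `pow_sub_mul_eta_le`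
  (`L^{n−j}η ≤ (1∕2)^{j+1}` on `ηL^{n+1} = 1`, `2 ≤ L`), **`sum_companion_le`** (`Σ_{j<n+1} c_j ≤ 3ℓ′ + (2d+1)ℓ` for the per-level companion distances
  `c_0 = 3ℓ′ + L^{n+1}ℓη`, `c_j = 2dL^{n+1−j}ℓη` of `B9Eq349TowerCutoffReadings` ∕ `B9Eq349ConjugatedQTowerLettersCompanion`).
* §2 **`tower_dQ_diff_le_linear`** — THE TOWER `dQ` WINDOW IS LINEAR IN `r` WITH A HEIGHT-FREE SLOPE:
  `Π(1 + √(L^d)(θ_j + e_j(r))) − Π(1 + √(L^d)θ_j) ≤ e·exp(√(L^d)√(2d)·102(d+1)²L·ε_s∕(1−ϱ))·(√(L^d)·r·(3ℓ′ + (2d+1)ℓ)·2√(2(2d(102(d+1)²Lε_s)² + 1)))`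
  under `√(L^d)·r·(3ℓ′ + (2d+1)ℓ)·2√(…) ≤ 1`.
* §3 (`ℓ = ℓ′ = 1`) **`radiusT0_pos`** (`0 < r₀ = min` of nine ratios), `le_ratios_of_le_radiusT0`, **`eta_windows`** (`hwin`, `hwin0`, `hwin1`, `hwin′`),
  **`unit_windows`** (`β ≤ 1`, `β′ ≤ 1`, `small′`, `hwinκ`, `0 ≤ ρ ≤ 1∕8`, the tower `dQ` window), **`slopes_le`** (`hβCC`, `hβC`, `hβD`, the `dQ` slope, `hβ′D`,
  `hβ′Q`, `0 ≤ β_K`), **`small_window`** (`p_K⁰∕2 + (21+3a)β² + 4βC_P + 2ρC_P² + β_K ≤ γ∕4`), **`small2_window`** (the second Neumann window `≤ μ₁∕2` at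
  `C_Q = M_φ′M_φ·exp(√(L^d)√(2d)·102(d+1)²L·ε_s∕(1−ϱ))`, `C_P = √(M∕√κ₁)`).
HONEST SCOPE.  Real arithmetic; the letters `γ` (Thm 3.11 for `Δ_{a,k}`), `μ₁` ([B11] (45) — `B9Eq3126QG1QLowerDiagonalClosed`), `γ′`, `κ₁`, `M` (the `G′_k` side),
`p_K⁰` (a bound of the curvature letter), the model letters are INPUTS; crude constants; NOT print's `δ₀`; NOT NE9 (cell pub-balaban: NE9 NOT PRINTED ∕ NOT PROVED;
«NE9 ⇐ the named binders»; row WALLED ON A MODEL (O-NE9-1; #5 UNRULED); spine PROVED 0∕9; rung (B)+1 on a finite T⁴ — NOT infinite volume, NOT mass gap, NOT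
BetaPertH, NOT Clay; HONEST DEPENDENCY: continuum YM on T⁴ ⇐ BetaPertH ∧ nine spine estimates (0/9 proved); BetaPertH ⇐ (D1) ∧ (D4) ∧ CAP+tail; G-an2-4 gates asym,
D1 and NE2/3/4).  NEW file; nothing modified.  Net new unproved facts: 0.
-/

noncomputable section

open scoped BigOperators
open Finset

namespace Literature.MathematicalPhysics.QuantumFieldTheory.Balaban1983to89.B9Eq3126ClosingRadiusWindowTower

open B9Eq349ConjugatedQTowerLetterLinear (prod_one_add_mul_add_sub_prod_le_linear_of_le prod_one_add_le_exp_sum)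

/-! ## §1 Geometric bookkeeping of the tower: level windows and per-level companion distances -/

/-- `Σ_{j<n} (1∕2)^{j+1} = 1 − (1∕2)^n ≤ 1`. [folklore] [cite: Balaban1985BackgroundPropagators, (3.15) p.393] -/
theorem sum_half_pow_succ_le_one (n : ℕ) : ∑ j ∈ range n, (1 / 2 : ℝ) ^ (j + 1) ≤ 1 := by
  have h : ∑ j ∈ range n, (1 / 2 : ℝ) ^ (j + 1) = 1 - (1 / 2 : ℝ) ^ n := by
    induction n with
    | zero => simp
    | succ k ih => rw [sum_range_succ, ih]; ring
  rw [h]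
  have : (0 : ℝ) ≤ (1 / 2 : ℝ) ^ n := by positivity
  linarith

/-- a geometric level-window profile sums height-free: `ε_j ≤ ε_s ϱ^j` (`0 ≤ ϱ < 1`) for `j < n+1` ⟹ `Σ_{j<n+1} ε_j ≤ ε_s∕(1−ϱ)`. [folklore]
[cite: Balaban1985BackgroundPropagators, (3.35)–(3.37) p.396, (3.79) p.406] -/
theorem sum_levelWindow_le (n : ℕ) (εU : ℕ → ℝ) {ϱ εs : ℝ} (hϱ0 : 0 ≤ ϱ) (hϱ1 : ϱ < 1) (hεs : 0 ≤ εs)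
    (hεg : ∀ j < n + 1, εU j ≤ εs * ϱ ^ j) : ∑ j ∈ range (n + 1), εU j ≤ εs / (1 - ϱ) := by
  have h1 : ∑ j ∈ range (n + 1), εU j ≤ ∑ j ∈ range (n + 1), εs * ϱ ^ j :=
    sum_le_sum fun j hj => hεg j (mem_range.mp hj)
  have hgeom : (∑ j ∈ range (n + 1), ϱ ^ j) * (1 - ϱ) = 1 - ϱ ^ (n + 1) := by
    have := geom_sum_mul ϱ (n + 1)
    linarith [this]
  have h2 : ∑ j ∈ range (n + 1), ϱ ^ j ≤ 1 / (1 - ϱ) := by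
    rw [le_div_iff₀ (by linarith), hgeom]
    have : 0 ≤ ϱ ^ (n + 1) := by positivity
    linarith
  calc ∑ j ∈ range (n + 1), εU j ≤ ∑ j ∈ range (n + 1), εs * ϱ ^ j := h1
    _ = εs * ∑ j ∈ range (n + 1), ϱ ^ j := by rw [mul_sum]
    _ ≤ εs * (1 / (1 - ϱ)) := mul_le_mul_of_nonneg_left h2 hεs
    _ = εs / (1 - ϱ) := by ring

/-- on the diagonal `ηL^{n+1} = 1` the level-`j+1` companion distance is `L^{n−j}η = (L^{j+1})⁻¹ ≤ (1∕2)^{j+1}` (`2 ≤ L`, `j < n+1`). [folklore]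
[cite: Balaban1985BackgroundPropagators, (3.15) p.393] -/
theorem pow_sub_mul_eta_le {L : ℕ} (hL2 : 2 ≤ L) {n j : ℕ} (hj : j < n + 1) {η : ℝ} (hηL : η * (L : ℝ) ^ (n + 1) = 1) :
    (L : ℝ) ^ (n - j) * η ≤ (1 / 2 : ℝ) ^ (j + 1) := by
  have hL0 : (0 : ℝ) < L := by exact_mod_cast (lt_of_lt_of_le (by norm_num) hL2 : 0 < L)
  have hLj : (0 : ℝ) < (L : ℝ) ^ (j + 1) := by positivity
  have hsplit : (L : ℝ) ^ (n + 1) = (L : ℝ) ^ (n - j) * (L : ℝ) ^ (j + 1) := by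
    rw [← pow_add]; congr 1; omega
  have hη : (L : ℝ) ^ (n - j) * η = ((L : ℝ) ^ (j + 1))⁻¹ := by
    apply eq_inv_of_mul_eq_one_left
    calc (L : ℝ) ^ (n - j) * η * (L : ℝ) ^ (j + 1) = η * ((L : ℝ) ^ (n - j) * (L : ℝ) ^ (j + 1)) := by ring
      _ = η * (L : ℝ) ^ (n + 1) := by rw [← hsplit]
      _ = 1 := hηL
  rw [hη, ← inv_pow, show (1 / 2 : ℝ) = (2 : ℝ)⁻¹ by norm_num, inv_pow, inv_pow]
  have h2L : (2 : ℝ) ^ (j + 1) ≤ (L : ℝ) ^ (j + 1) := pow_le_pow_left₀ (by norm_num) (by exact_mod_cast hL2) _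
  exact inv_anti₀ (by positivity) h2L

/-- **the per-level companion distances sum height-free**: with `c_0 = 3ℓ′ + L^{n+1}ℓη` and `c_j = 2dL^{n+1−j}ℓη` (`1 ≤ j ≤ n`) on the diagonal
`ηL^{n+1} = 1`, `2 ≤ L`: `Σ_{j<n+1} c_j ≤ 3ℓ′ + (2d+1)ℓ`. [folklore] [cite: Balaban1985BackgroundPropagators, (3.15) p.393, (3.49) p.399] -/
theorem sum_companion_le {d L : ℕ} (hL2 : 2 ≤ L) (n : ℕ) {η : ℝ} (hηL : η * (L : ℝ) ^ (n + 1) = 1) {ℓ ℓ' : ℝ} (hℓ : 0 ≤ ℓ) :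
    ∑ j ∈ range (n + 1), (if j = 0 then 3 * ℓ' + (L : ℝ) ^ (n + 1) * (ℓ * η) else 2 * d * (L : ℝ) ^ (n + 1 - j) * (ℓ * η)) ≤
      3 * ℓ' + (2 * d + 1) * ℓ := by
  rw [sum_range_succ']
  simp only [Nat.succ_ne_zero, ↓reduceIte, Nat.add_sub_add_right]
  have h0 : (L : ℝ) ^ (n + 1) * (ℓ * η) = ℓ := by
    calc (L : ℝ) ^ (n + 1) * (ℓ * η) = ℓ * (η * (L : ℝ) ^ (n + 1)) := by ring
      _ = ℓ := by rw [hηL, mul_one]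
  have h1 : ∑ j ∈ range n, 2 * (d : ℝ) * (L : ℝ) ^ (n - j) * (ℓ * η) ≤ 2 * d * ℓ := by
    have hterm : ∀ j ∈ range n, 2 * (d : ℝ) * (L : ℝ) ^ (n - j) * (ℓ * η) ≤ 2 * d * ℓ * (1 / 2 : ℝ) ^ (j + 1) := by
      intro j hj
      have hj' : j < n + 1 := by have := mem_range.mp hj; omega
      have h := pow_sub_mul_eta_le hL2 hj' hηL
      calc 2 * (d : ℝ) * (L : ℝ) ^ (n - j) * (ℓ * η) = 2 * d * ℓ * ((L : ℝ) ^ (n - j) * η) := by ring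
        _ ≤ 2 * d * ℓ * (1 / 2 : ℝ) ^ (j + 1) := mul_le_mul_of_nonneg_left h (by positivity)
    calc ∑ j ∈ range n, 2 * (d : ℝ) * (L : ℝ) ^ (n - j) * (ℓ * η) ≤ ∑ j ∈ range n, 2 * d * ℓ * (1 / 2 : ℝ) ^ (j + 1) := sum_le_sum hterm
      _ = 2 * d * ℓ * ∑ j ∈ range n, (1 / 2 : ℝ) ^ (j + 1) := by rw [mul_sum]
      _ ≤ 2 * d * ℓ * 1 := mul_le_mul_of_nonneg_left (sum_half_pow_succ_le_one n) (by positivity)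
      _ = 2 * d * ℓ := mul_one _
  rw [h0]
  linarith

/-! ## §2 The tower `dQ` window is LINEAR in the radius with a HEIGHT-FREE slope -/

/-- **THE TOWER CONJUGATION LETTER OF `Q_k(U)` IS LINEAR IN THE RADIUS, HEIGHT-FREE**: on the diagonal `ηL^{n+1} = 1` (`2 ≤ L`) and a geometric
bond-window profile `ε_j ≤ ε_sϱ^j` (`0 ≤ ϱ < 1`), the product difference of `B9Eq349ConjugatedQTowerLettersCompanion` ∕ the `hβT` window of
`B9Eq3126H1BlockDecayTowerClosed` obeys, for `√(L^d)·r·(3ℓ′ + (2d+1)ℓ)·2√(2(2d(102(d+1)²Lε_s)² + 1)) ≤ 1`,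
`Π_{j<n+1}(1 + √(L^d)(θ_j + e_j(r))) − Π_{j<n+1}(1 + √(L^d)θ_j) ≤ e·exp(√(L^d)√(2d)·102(d+1)²L·ε_s∕(1−ϱ))·(√(L^d)·r·(3ℓ′ + (2d+1)ℓ)·2√(2(2d(102(d+1)²Lε_s)² + 1)))`
(`θ_j = √(2d)·102(d+1)²Lε_j`, `e_j(r) = 2(r c_j)√(2(2d(102(d+1)²Lε_j)² + (L^d)⁻¹)`) — `B9Eq349ConjugatedQTowerLetterLinear.prod_one_add_mul_add_sub_prod_le_linear_of_le`
(t4-ne9-idea-1 L-g148-3) at the geometric sums of §1. [cite: Balaban1985BackgroundPropagators, (3.15) p.393, (3.42) p.397, (3.49) p.399, (3.79) p.406] -/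
theorem tower_dQ_diff_le_linear {d L : ℕ} (hL2 : 2 ≤ L) (n : ℕ) {η : ℝ} (hηL : η * (L : ℝ) ^ (n + 1) = 1) (εU : ℕ → ℝ)
    (hεU : ∀ j, 0 ≤ εU j) {ϱ εs : ℝ} (hϱ0 : 0 ≤ ϱ) (hϱ1 : ϱ < 1) (hεs : 0 ≤ εs) (hεg : ∀ j < n + 1, εU j ≤ εs * ϱ ^ j)
    {r ℓ ℓ' : ℝ} (hr : 0 ≤ r) (hℓ : 0 ≤ ℓ) (hℓ' : 0 ≤ ℓ')
    (hwinT : Real.sqrt ((L : ℝ) ^ d) * r * ((3 * ℓ' + (2 * d + 1) * ℓ) * (2 * Real.sqrt (2 * (2 * d * (102 * (d + 1) ^ 2 * L * εs) ^ 2 + 1)))) ≤ 1) :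
    (∏ j ∈ range (n + 1), (1 + Real.sqrt ((L : ℝ) ^ d) * (Real.sqrt (2 * d) * (102 * (d + 1) ^ 2 * L * εU j) +
        2 * (r * (if j = 0 then 3 * ℓ' + (L : ℝ) ^ (n + 1) * (ℓ * η) else 2 * d * (L : ℝ) ^ (n + 1 - j) * (ℓ * η))) *
          Real.sqrt (2 * (2 * d * (102 * (d + 1) ^ 2 * L * εU j) ^ 2 + ((L : ℝ) ^ d)⁻¹))))) -
      ∏ j ∈ range (n + 1), (1 + Real.sqrt ((L : ℝ) ^ d) * (Real.sqrt (2 * d) * (102 * (d + 1) ^ 2 * L * εU j))) ≤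
      Real.exp 1 * Real.exp (Real.sqrt ((L : ℝ) ^ d) * (Real.sqrt (2 * d) * (102 * (d + 1) ^ 2 * L)) * (εs / (1 - ϱ))) *
        (Real.sqrt ((L : ℝ) ^ d) * r * ((3 * ℓ' + (2 * d + 1) * ℓ) * (2 * Real.sqrt (2 * (2 * d * (102 * (d + 1) ^ 2 * L * εs) ^ 2 + 1))))) := by
  have hL1 : (1 : ℝ) ≤ L := by exact_mod_cast (le_trans (by norm_num) hL2 : 1 ≤ L)
  have hc : 0 ≤ Real.sqrt ((L : ℝ) ^ d) := Real.sqrt_nonneg _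
  -- the levels' windows are below `ε_s`, and `(L^d)⁻¹ ≤ 1`
  have hεle : ∀ j ∈ range (n + 1), εU j ≤ εs := fun j hj => by
    have h := hεg j (mem_range.mp hj)
    have : εs * ϱ ^ j ≤ εs * 1 := mul_le_mul_of_nonneg_left (pow_le_one₀ hϱ0 hϱ1.le) hεs
    linarith
  have hLd : ((L : ℝ) ^ d)⁻¹ ≤ 1 := inv_le_one_of_one_le₀ (one_le_pow₀ hL1)
  -- the per-level radius letters `e_j ≤ r·a_j`
  set S : ℝ := Real.sqrt (2 * (2 * d * (102 * (d + 1) ^ 2 * L * εs) ^ 2 + 1)) with hS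
  have hS0 : 0 ≤ S := Real.sqrt_nonneg _
  have hcoef0 : ∀ j ∈ range (n + 1), 0 ≤ (if j = 0 then 3 * ℓ' + (L : ℝ) ^ (n + 1) * (ℓ * η) else 2 * d * (L : ℝ) ^ (n + 1 - j) * (ℓ * η)) := by
    intro j _
    have hη0 : 0 ≤ η := by
      have hLp : (0 : ℝ) < (L : ℝ) ^ (n + 1) := by positivity
      nlinarith
    split_ifs <;> positivity
  have hea : ∀ j ∈ range (n + 1),
      2 * (r * (if j = 0 then 3 * ℓ' + (L : ℝ) ^ (n + 1) * (ℓ * η) else 2 * d * (L : ℝ) ^ (n + 1 - j) * (ℓ * η))) *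
          Real.sqrt (2 * (2 * d * (102 * (d + 1) ^ 2 * L * εU j) ^ 2 + ((L : ℝ) ^ d)⁻¹)) ≤
        r * ((if j = 0 then 3 * ℓ' + (L : ℝ) ^ (n + 1) * (ℓ * η) else 2 * d * (L : ℝ) ^ (n + 1 - j) * (ℓ * η)) * (2 * S)) := by
    intro j hj
    have hsq : Real.sqrt (2 * (2 * d * (102 * (d + 1) ^ 2 * L * εU j) ^ 2 + ((L : ℝ) ^ d)⁻¹)) ≤ S := by
      apply Real.sqrt_le_sqrt
      have h1 : (102 * (d + 1) ^ 2 * L * εU j) ^ 2 ≤ (102 * (d + 1) ^ 2 * L * εs) ^ 2 :=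
        pow_le_pow_left₀ (by have := hεU j; positivity) (mul_le_mul_of_nonneg_left (hεle j hj) (by positivity)) 2
      have h1' : 2 * (d : ℝ) * (102 * (d + 1) ^ 2 * L * εU j) ^ 2 ≤ 2 * d * (102 * (d + 1) ^ 2 * L * εs) ^ 2 :=
        mul_le_mul_of_nonneg_left h1 (by positivity)
      linarith
    have hcj := hcoef0 j hj
    calc 2 * (r * (if j = 0 then 3 * ℓ' + (L : ℝ) ^ (n + 1) * (ℓ * η) else 2 * d * (L : ℝ) ^ (n + 1 - j) * (ℓ * η))) *
          Real.sqrt (2 * (2 * d * (102 * (d + 1) ^ 2 * L * εU j) ^ 2 + ((L : ℝ) ^ d)⁻¹))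
        ≤ 2 * (r * (if j = 0 then 3 * ℓ' + (L : ℝ) ^ (n + 1) * (ℓ * η) else 2 * d * (L : ℝ) ^ (n + 1 - j) * (ℓ * η))) * S :=
          mul_le_mul_of_nonneg_left hsq (by positivity)
      _ = _ := by ring
  -- the height-free sum of the `a_j`
  have hsumA : ∑ j ∈ range (n + 1), (if j = 0 then 3 * ℓ' + (L : ℝ) ^ (n + 1) * (ℓ * η) else 2 * d * (L : ℝ) ^ (n + 1 - j) * (ℓ * η)) * (2 * S) ≤
      (3 * ℓ' + (2 * d + 1) * ℓ) * (2 * S) := by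
    rw [← sum_mul]
    exact mul_le_mul_of_nonneg_right (sum_companion_le hL2 n hηL hℓ) (by positivity)
  have hwin : Real.sqrt ((L : ℝ) ^ d) * r *
      ∑ j ∈ range (n + 1), (if j = 0 then 3 * ℓ' + (L : ℝ) ^ (n + 1) * (ℓ * η) else 2 * d * (L : ℝ) ^ (n + 1 - j) * (ℓ * η)) * (2 * S) ≤ 1 :=
    (mul_le_mul_of_nonneg_left hsumA (by positivity)).trans hwinT
  have hθ : ∀ j ∈ range (n + 1), 0 ≤ Real.sqrt (2 * d) * (102 * (d + 1) ^ 2 * L * εU j) := fun j _ => by have := hεU j; positivity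
  have he : ∀ j ∈ range (n + 1), 0 ≤ 2 * (r * (if j = 0 then 3 * ℓ' + (L : ℝ) ^ (n + 1) * (ℓ * η) else 2 * d * (L : ℝ) ^ (n + 1 - j) * (ℓ * η))) *
      Real.sqrt (2 * (2 * d * (102 * (d + 1) ^ 2 * L * εU j) ^ 2 + ((L : ℝ) ^ d)⁻¹)) := fun j hj => by
    have := hcoef0 j hj; positivity
  have hmain := prod_one_add_mul_add_sub_prod_le_linear_of_le (range (n + 1)) hc hθ he hea hwin
  -- the flat product `P ≤ exp(√(L^d)·√(2d)·102(d+1)²L·ε_s∕(1−ϱ))`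
  have hP : ∏ j ∈ range (n + 1), (1 + Real.sqrt ((L : ℝ) ^ d) * (Real.sqrt (2 * d) * (102 * (d + 1) ^ 2 * L * εU j))) ≤
      Real.exp (Real.sqrt ((L : ℝ) ^ d) * (Real.sqrt (2 * d) * (102 * (d + 1) ^ 2 * L)) * (εs / (1 - ϱ))) := by
    have h1 := prod_one_add_le_exp_sum (range (n + 1)) (y := fun j => Real.sqrt ((L : ℝ) ^ d) * (Real.sqrt (2 * d) * (102 * (d + 1) ^ 2 * L * εU j)))
      (fun j hj => mul_nonneg hc (hθ j hj))
    refine h1.trans (Real.exp_le_exp.mpr ?_)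
    have hsum := sum_levelWindow_le n εU hϱ0 hϱ1 hεs hεg
    have hK : 0 ≤ Real.sqrt ((L : ℝ) ^ d) * (Real.sqrt (2 * d) * (102 * (d + 1) ^ 2 * L)) := by positivity
    calc ∑ j ∈ range (n + 1), Real.sqrt ((L : ℝ) ^ d) * (Real.sqrt (2 * d) * (102 * (d + 1) ^ 2 * L * εU j))
        = Real.sqrt ((L : ℝ) ^ d) * (Real.sqrt (2 * d) * (102 * (d + 1) ^ 2 * L)) * ∑ j ∈ range (n + 1), εU j := by
          rw [mul_sum]; refine sum_congr rfl fun j _ => by ring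
      _ ≤ Real.sqrt ((L : ℝ) ^ d) * (Real.sqrt (2 * d) * (102 * (d + 1) ^ 2 * L)) * (εs / (1 - ϱ)) := mul_le_mul_of_nonneg_left hsum hK
  have hP0 : 0 ≤ ∏ j ∈ range (n + 1), (1 + Real.sqrt ((L : ℝ) ^ d) * (Real.sqrt (2 * d) * (102 * (d + 1) ^ 2 * L * εU j))) :=
    prod_nonneg fun j hj => by have := hθ j hj; positivity
  have hT0 : 0 ≤ Real.sqrt ((L : ℝ) ^ d) * r *
      ∑ j ∈ range (n + 1), (if j = 0 then 3 * ℓ' + (L : ℝ) ^ (n + 1) * (ℓ * η) else 2 * d * (L : ℝ) ^ (n + 1 - j) * (ℓ * η)) * (2 * S) :=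
    mul_nonneg (by positivity) (sum_nonneg fun j hj => mul_nonneg (hcoef0 j hj) (by positivity))
  calc _ ≤ Real.exp 1 * (∏ j ∈ range (n + 1), (1 + Real.sqrt ((L : ℝ) ^ d) * (Real.sqrt (2 * d) * (102 * (d + 1) ^ 2 * L * εU j)))) *
        (Real.sqrt ((L : ℝ) ^ d) * r *
          ∑ j ∈ range (n + 1), (if j = 0 then 3 * ℓ' + (L : ℝ) ^ (n + 1) * (ℓ * η) else 2 * d * (L : ℝ) ^ (n + 1 - j) * (ℓ * η)) * (2 * S)) := hmain
    _ ≤ Real.exp 1 * Real.exp (Real.sqrt ((L : ℝ) ^ d) * (Real.sqrt (2 * d) * (102 * (d + 1) ^ 2 * L)) * (εs / (1 - ϱ))) *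
        (Real.sqrt ((L : ℝ) ^ d) * r * ((3 * ℓ' + (2 * d + 1) * ℓ) * (2 * S))) := by
      apply mul_le_mul (mul_le_mul_of_nonneg_left hP (Real.exp_pos 1).le) (mul_le_mul_of_nonneg_left hsumA (by positivity)) hT0
      positivity


/-! ## §3 The closing radius of the tower `H₁` row: every window of `B9Eq3126H1BlockDecayTowerClosed` from ONE `r ≤ r₀` -/

section Closing

variable {d L : ℕ} {Mφ Mφ' a a' εs ϱ γ' κ₁ M γ μ₁ pK0 : ℝ}

/-- **THE CLOSING RADIUS `r₀` OF THE TOWER `H₁` ROW IS POSITIVE** — nine ratios over the letters `(d, L, M_φ, M_φ′, a, a′, ε_s, ϱ, γ′, κ₁, M, γ, μ₁, p_K⁰)`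
with `γ, μ₁, γ′, κ₁ > 0` and the curvature gap `p_K⁰ < γ∕2`; NO height, NO lattice, NO background. [folklore]
[cite: Balaban1985BackgroundPropagators, (3.49) p.399, Thm 3.11 p.416; Balaban1985Variational, (45) p.285] -/
theorem radiusT0_pos (hL : 1 ≤ L) (hMφ : 0 ≤ Mφ) (hMφ' : 0 ≤ Mφ') (ha : 0 ≤ a) (ha' : 0 ≤ a') (hγ' : 0 < γ') (hκ₁ : 0 < κ₁) (hM : 0 ≤ M)
    (hγ : 0 < γ) (hμ₁ : 0 < μ₁) (hpK0 : 0 ≤ pK0) (hgap : pK0 < γ / 2) :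
    0 < min (1 / 4) (min (1 / (2 * (d : ℝ) + 1)) (min (1 / (4 * (Mφ * Mφ') * (d * Real.sqrt d) + 4 * (Mφ * Mφ') * d + 2 * (Mφ * Mφ') * Real.sqrt d + Mφ' * Mφ * (Real.exp 1 * Real.exp (Real.sqrt ((L : ℝ) ^ d) * (Real.sqrt (2 * d) * (102 * (d + 1) ^ 2 * L)) * (εs / (1 - ϱ))) * (Real.sqrt ((L : ℝ) ^ d) * ((3 * 1 + (2 * d + 1) * 1) * (2 * Real.sqrt (2 * (2 * d * (102 * (d + 1) ^ 2 * L * εs) ^ 2 + 1)))))) + 1)) (min (1 / (Real.sqrt ((L : ℝ) ^ d) * ((3 * 1 + (2 * d + 1) * 1) * (2 * Real.sqrt (2 * (2 * d * (102 * (d + 1) ^ 2 * L * εs) ^ 2 + 1)))))) (min (1 / (2 * (Mφ * Mφ') * Real.sqrt d + 2 * M + 1)) (min (γ' / (12 * (1 + a') * (2 * (Mφ * Mφ') * Real.sqrt d + 2 * M + 1))) (min (Real.sqrt κ₁ / (120 * ((2 * (Mφ * Mφ') * Real.sqrt d + 2 * M + 1) * (4 / γ' + M * ((4 / γ') ^ 2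 * (3 + a' * (2 * M + 1))))))) (min ((γ / 4 - pK0 / 2) / ((21 + 3 * a) * (4 * (Mφ * Mφ') * (d * Real.sqrt d) + 4 * (Mφ * Mφ') * d + 2 * (Mφ * Mφ') * Real.sqrt d + Mφ' * Mφ * (Real.exp 1 * Real.exp (Real.sqrt ((L : ℝ) ^ d) * (Real.sqrt (2 * d) * (102 * (d + 1) ^ 2 * L)) * (εs / (1 - ϱ))) * (Real.sqrt ((L : ℝ) ^ d) * ((3 * 1 + (2 * d + 1) * 1) * (2 * Real.sqrt (2 * (2 * d * (102 * (d + 1) ^ 2 * L * εs) ^ 2 + 1)))))) + 1) + 4 * (4 * (Mφ * Mφ') * (d * Real.sqrt d) + 4 * (Mφ * Mφ') * d + 2 * (Mφ * Mφ') * Real.sqrt d + Mφ' * Mφ * (Real.exp 1 * Real.exp (Real.sqrt ((L : ℝ) ^ d) * (Real.sqrt (2 * d) * (102 * (d + 1) ^ 2 * L)) * (εs / (1 - ϱ))) * (Real.sqrt ((L : ℝ) ^ d) * ((3 * 1 + (2 * d + 1) * 1) * (2 * Real.sqrt (2 * (2 * d * (102 * (d + 1) ^ 2 * L * εs) ^ 2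 + 1)))))) + 1) * Real.sqrt (M / Real.sqrt κ₁) + 2 * (15 * ((2 * (Mφ * Mφ') * Real.sqrt d + 2 * M + 1) * (4 / γ' + M * ((4 / γ') ^ 2 * (3 + a' * (2 * M + 1))))) / Real.sqrt κ₁) * Real.sqrt (M / Real.sqrt κ₁) ^ 2 + 8 * pK0)) ((μ₁ / 2) / ((4 * (Mφ * Mφ') * (d * Real.sqrt d) + 4 * (Mφ * Mφ') * d + 2 * (Mφ * Mφ') * Real.sqrt d + Mφ' * Mφ * (Real.exp 1 * Real.exp (Real.sqrt ((L : ℝ) ^ d) * (Real.sqrt (2 * d) * (102 * (d + 1) ^ 2 * L)) * (εs / (1 - ϱ))) * (Real.sqrt ((L : ℝ) ^ d) * ((3 * 1 + (2 * d + 1) * 1) * (2 * Real.sqrt (2 * (2 * d * (102 * (d + 1) ^ 2 * L * εs) ^ 2 + 1)))))) + 1) * (4 / γ) * (2 * (Mφ' * Mφ * Real.exp (Real.sqrt ((L : ℝ) ^ d) * (Real.sqrt (2 * d) * (102 * (d + 1) ^ 2 * L)) * (εs / (1 - ϱ)))) + 1) + (Mφ' * Mφ * Real.exp (Real.sqrt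 ((L : ℝ) ^ d) * (Real.sqrt (2 * d) * (102 * (d + 1) ^ 2 * L)) * (εs / (1 - ϱ)))) * ((Mφ' * Mφ * Real.exp (Real.sqrt ((L : ℝ) ^ d) * (Real.sqrt (2 * d) * (102 * (d + 1) ^ 2 * L)) * (εs / (1 - ϱ)))) + 1) * ((4 * (Mφ * Mφ') * (d * Real.sqrt d) + 4 * (Mφ * Mφ') * d + 2 * (Mφ * Mφ') * Real.sqrt d + Mφ' * Mφ * (Real.exp 1 * Real.exp (Real.sqrt ((L : ℝ) ^ d) * (Real.sqrt (2 * d) * (102 * (d + 1) ^ 2 * L)) * (εs / (1 - ϱ))) * (Real.sqrt ((L : ℝ) ^ d) * ((3 * 1 + (2 * d + 1) * 1) * (2 * Real.sqrt (2 * (2 * d * (102 * (d + 1) ^ 2 * L * εs) ^ 2 + 1)))))) + 1) * (4 / γ * (2 * (8 / γ) + (8 / γ + 4 / γ) + 2 * ((8 / γ + 4 / γ * Real.sqrt (M / Real.sqrt κ₁)) + 4 / γ) + a * (Mφ' * Mφ * Real.exp (Real.sqrt ((L : ℝ) ^ d) * (Real.sqrt (2 * d) * (102 * (d + 1) ^ 2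 * L)) * (εs / (1 - ϱ)))) * (4 / γ) + a * ((Mφ' * Mφ * Real.exp (Real.sqrt ((L : ℝ) ^ d) * (Real.sqrt (2 * d) * (102 * (d + 1) ^ 2 * L)) * (εs / (1 - ϱ)))) + 1) * (4 / γ))) + (15 * ((2 * (Mφ * Mφ') * Real.sqrt d + 2 * M + 1) * (4 / γ' + M * ((4 / γ') ^ 2 * (3 + a' * (2 * M + 1))))) / Real.sqrt κ₁) * ((8 / γ + 4 / γ * Real.sqrt (M / Real.sqrt κ₁)) * ((8 / γ + 4 / γ * Real.sqrt (M / Real.sqrt κ₁)) + 4 / γ)) + 8 * pK0 * (4 / γ) ^ 2)))))))))) := by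
  have hL0 : (0 : ℝ) < L := by exact_mod_cast (lt_of_lt_of_le zero_lt_one hL)
  have hsq : 0 < Real.sqrt κ₁ := Real.sqrt_pos.mpr hκ₁
  have hS : 0 < Real.sqrt (2 * (2 * d * (102 * (d + 1) ^ 2 * L * εs) ^ 2 + 1)) := Real.sqrt_pos.mpr (by positivity)
  have hLd : 0 < Real.sqrt ((L : ℝ) ^ d) := Real.sqrt_pos.mpr (by positivity)
  have hNB : 0 < (4 * (Mφ * Mφ') * (d * Real.sqrt d) + 4 * (Mφ * Mφ') * d + 2 * (Mφ * Mφ') * Real.sqrt d + Mφ' * Mφ * (Real.exp 1 * Real.exp (Real.sqrt ((L : ℝ) ^ d) * (Real.sqrt (2 * d) * (102 * (d + 1) ^ 2 * L)) * (εs / (1 - ϱ))) * (Real.sqrt ((L : ℝ) ^ d) * ((3 * 1 + (2 * d + 1) * 1) * (2 * Real.sqrt (2 * (2 * d * (102 * (d + 1) ^ 2 * L * εs) ^ 2 + 1)))))) + 1) := by positivity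
  have hNP : 0 < (2 * (Mφ * Mφ') * Real.sqrt d + 2 * M + 1) := by positivity
  have hX0 : 0 < (4 / γ' + M * ((4 / γ') ^ 2 * (3 + a' * (2 * M + 1)))) := by positivity
  have hS1 : 0 < ((21 + 3 * a) * (4 * (Mφ * Mφ') * (d * Real.sqrt d) + 4 * (Mφ * Mφ') * d + 2 * (Mφ * Mφ') * Real.sqrt d + Mφ' * Mφ * (Real.exp 1 * Real.exp (Real.sqrt ((L : ℝ) ^ d) * (Real.sqrt (2 * d) * (102 * (d + 1) ^ 2 * L)) * (εs / (1 - ϱ))) * (Real.sqrt ((L : ℝ) ^ d) * ((3 * 1 + (2 * d + 1) * 1) * (2 * Real.sqrt (2 * (2 * d * (102 * (d + 1) ^ 2 * L * εs) ^ 2 + 1)))))) + 1) + 4 * (4 * (Mφ * Mφ') * (d * Real.sqrt d) + 4 * (Mφ * Mφ') * d + 2 * (Mφ * Mφ') * Real.sqrt d + Mφ' * Mφ * (Real.exp 1 * Real.exp (Real.sqrt ((L : ℝ) ^ d) * (Real.sqrt (2 * d) * (102 * (d + 1) ^ 2 * L)) * (εs / (1 - ϱ))) * (Real.sqrt ((L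 : ℝ) ^ d) * ((3 * 1 + (2 * d + 1) * 1) * (2 * Real.sqrt (2 * (2 * d * (102 * (d + 1) ^ 2 * L * εs) ^ 2 + 1)))))) + 1) * Real.sqrt (M / Real.sqrt κ₁) + 2 * (15 * ((2 * (Mφ * Mφ') * Real.sqrt d + 2 * M + 1) * (4 / γ' + M * ((4 / γ') ^ 2 * (3 + a' * (2 * M + 1))))) / Real.sqrt κ₁) * Real.sqrt (M / Real.sqrt κ₁) ^ 2 + 8 * pK0) := by positivity
  have hS2 : 0 < ((4 * (Mφ * Mφ') * (d * Real.sqrt d) + 4 * (Mφ * Mφ') * d + 2 * (Mφ * Mφ') * Real.sqrt d + Mφ' * Mφ * (Real.exp 1 * Real.exp (Real.sqrt ((L : ℝ) ^ d) * (Real.sqrt (2 * d) * (102 * (d + 1) ^ 2 * L)) * (εs / (1 - ϱ))) * (Real.sqrt ((L : ℝ) ^ d) * ((3 * 1 + (2 * d + 1) * 1) * (2 * Real.sqrt (2 * (2 * d * (102 * (d + 1) ^ 2 * L * εs) ^ 2 + 1)))))) + 1) * (4 / γ) * (2 * (Mφ' * Mφ * Real.exp (Real.sqrt ((L : ℝ)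 ^ d) * (Real.sqrt (2 * d) * (102 * (d + 1) ^ 2 * L)) * (εs / (1 - ϱ)))) + 1) + (Mφ' * Mφ * Real.exp (Real.sqrt ((L : ℝ) ^ d) * (Real.sqrt (2 * d) * (102 * (d + 1) ^ 2 * L)) * (εs / (1 - ϱ)))) * ((Mφ' * Mφ * Real.exp (Real.sqrt ((L : ℝ) ^ d) * (Real.sqrt (2 * d) * (102 * (d + 1) ^ 2 * L)) * (εs / (1 - ϱ)))) + 1) * ((4 * (Mφ * Mφ') * (d * Real.sqrt d) + 4 * (Mφ * Mφ') * d + 2 * (Mφ * Mφ') * Real.sqrt d + Mφ' * Mφ * (Real.exp 1 * Real.exp (Real.sqrt ((L : ℝ) ^ d) * (Real.sqrt (2 * d) * (102 * (d + 1) ^ 2 * L)) * (εs / (1 - ϱ))) * (Real.sqrt ((L : ℝ) ^ d) * ((3 * 1 + (2 * d + 1) * 1) * (2 * Real.sqrt (2 * (2 * d * (102 * (d + 1) ^ 2 * L * εs) ^ 2 + 1)))))) + 1) * (4 / γ * (2 * (8 / γ) + (8 / γ + 4 / γ) + 2 * ((8 / γ + 4 / γ * Real.sqrt (M / Real.sqrt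 κ₁)) + 4 / γ) + a * (Mφ' * Mφ * Real.exp (Real.sqrt ((L : ℝ) ^ d) * (Real.sqrt (2 * d) * (102 * (d + 1) ^ 2 * L)) * (εs / (1 - ϱ)))) * (4 / γ) + a * ((Mφ' * Mφ * Real.exp (Real.sqrt ((L : ℝ) ^ d) * (Real.sqrt (2 * d) * (102 * (d + 1) ^ 2 * L)) * (εs / (1 - ϱ)))) + 1) * (4 / γ))) + (15 * ((2 * (Mφ * Mφ') * Real.sqrt d + 2 * M + 1) * (4 / γ' + M * ((4 / γ') ^ 2 * (3 + a' * (2 * M + 1))))) / Real.sqrt κ₁) * ((8 / γ + 4 / γ * Real.sqrt (M / Real.sqrt κ₁)) * ((8 / γ + 4 / γ * Real.sqrt (M / Real.sqrt κ₁)) + 4 / γ)) + 8 * pK0 * (4 / γ) ^ 2)) := by positivity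
  have hg : 0 < γ / 4 - pK0 / 2 := by linarith
  refine lt_min (by norm_num) (lt_min (by positivity) (lt_min (by positivity) (lt_min (by positivity) (lt_min (by positivity)
    (lt_min (by positivity) (lt_min (by positivity) (lt_min (by positivity) (by positivity))))))))

/-- unpacking `r ≤ r₀` into the nine ratio bounds. [folklore] [cite: Balaban1985BackgroundPropagators, (3.49) p.399] -/
theorem le_ratios_of_le_radiusT0 {r : ℝ} (h : r ≤ min (1 / 4) (min (1 / (2 * (d : ℝ) + 1)) (min (1 / (4 * (Mφ * Mφ') * (d * Real.sqrt d) + 4 * (Mφ * Mφ') * d + 2 * (Mφ * Mφ') * Real.sqrt d + Mφ' * Mφ * (Real.exp 1 * Real.exp (Real.sqrt ((L : ℝ) ^ d) * (Real.sqrt (2 * d) * (102 * (d + 1) ^ 2 * L)) * (εs / (1 - ϱ))) * (Real.sqrt ((L : ℝ) ^ d) * ((3 * 1 + (2 * d + 1) * 1) * (2 * Real.sqrt (2 * (2 * d * (102 * (d + 1) ^ 2 * L * εs) ^ 2 + 1)))))) + 1)) (min (1 / (Real.sqrt ((L : ℝ) ^ d) * ((3 * 1 + (2 * d + 1) * 1)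 * (2 * Real.sqrt (2 * (2 * d * (102 * (d + 1) ^ 2 * L * εs) ^ 2 + 1)))))) (min (1 / (2 * (Mφ * Mφ') * Real.sqrt d + 2 * M + 1)) (min (γ' / (12 * (1 + a') * (2 * (Mφ * Mφ') * Real.sqrt d + 2 * M + 1))) (min (Real.sqrt κ₁ / (120 * ((2 * (Mφ * Mφ') * Real.sqrt d + 2 * M + 1) * (4 / γ' + M * ((4 / γ') ^ 2 * (3 + a' * (2 * M + 1))))))) (min ((γ / 4 - pK0 / 2) / ((21 + 3 * a) * (4 * (Mφ * Mφ') * (d * Real.sqrt d) + 4 * (Mφ * Mφ') * d + 2 * (Mφ * Mφ') * Real.sqrt d + Mφ' * Mφ * (Real.exp 1 * Real.exp (Real.sqrt ((L : ℝ) ^ d) * (Real.sqrt (2 * d) * (102 * (d + 1) ^ 2 * L)) * (εs / (1 - ϱ))) * (Real.sqrt ((L : ℝ) ^ d) * ((3 * 1 + (2 * d + 1) * 1) * (2 * Real.sqrt (2 * (2 * d * (102 * (d + 1) ^ 2 * L * εs) ^ 2 + 1)))))) + 1) + 4 * (4 * (Mφ * Mφ') * (d * Real.sqrt d) + 4 *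 (Mφ * Mφ') * d + 2 * (Mφ * Mφ') * Real.sqrt d + Mφ' * Mφ * (Real.exp 1 * Real.exp (Real.sqrt ((L : ℝ) ^ d) * (Real.sqrt (2 * d) * (102 * (d + 1) ^ 2 * L)) * (εs / (1 - ϱ))) * (Real.sqrt ((L : ℝ) ^ d) * ((3 * 1 + (2 * d + 1) * 1) * (2 * Real.sqrt (2 * (2 * d * (102 * (d + 1) ^ 2 * L * εs) ^ 2 + 1)))))) + 1) * Real.sqrt (M / Real.sqrt κ₁) + 2 * (15 * ((2 * (Mφ * Mφ') * Real.sqrt d + 2 * M + 1) * (4 / γ' + M * ((4 / γ') ^ 2 * (3 + a' * (2 * M + 1))))) / Real.sqrt κ₁) * Real.sqrt (M / Real.sqrt κ₁) ^ 2 + 8 * pK0)) ((μ₁ / 2) / ((4 * (Mφ * Mφ') * (d * Real.sqrt d) + 4 * (Mφ * Mφ') * d + 2 * (Mφ * Mφ') * Real.sqrt d + Mφ' * Mφ * (Real.exp 1 * Real.exp (Real.sqrt ((L : ℝ) ^ d) * (Real.sqrt (2 * d) * (102 * (d + 1) ^ 2 * L)) * (εs / (1 - ϱ))) * (Real.sqrt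 ((L : ℝ) ^ d) * ((3 * 1 + (2 * d + 1) * 1) * (2 * Real.sqrt (2 * (2 * d * (102 * (d + 1) ^ 2 * L * εs) ^ 2 + 1)))))) + 1) * (4 / γ) * (2 * (Mφ' * Mφ * Real.exp (Real.sqrt ((L : ℝ) ^ d) * (Real.sqrt (2 * d) * (102 * (d + 1) ^ 2 * L)) * (εs / (1 - ϱ)))) + 1) + (Mφ' * Mφ * Real.exp (Real.sqrt ((L : ℝ) ^ d) * (Real.sqrt (2 * d) * (102 * (d + 1) ^ 2 * L)) * (εs / (1 - ϱ)))) * ((Mφ' * Mφ * Real.exp (Real.sqrt ((L : ℝ) ^ d) * (Real.sqrt (2 * d) * (102 * (d + 1) ^ 2 * L)) * (εs / (1 - ϱ)))) + 1) * ((4 * (Mφ * Mφ') * (d * Real.sqrt d) + 4 * (Mφ * Mφ') * d + 2 * (Mφ * Mφ') * Real.sqrt d + Mφ' * Mφ * (Real.exp 1 * Real.exp (Real.sqrt ((L : ℝ) ^ d) * (Real.sqrt (2 * d) * (102 * (d + 1) ^ 2 * L)) * (εs / (1 - ϱ))) * (Real.sqrt ((L : ℝ) ^ d) * ((3 * 1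 + (2 * d + 1) * 1) * (2 * Real.sqrt (2 * (2 * d * (102 * (d + 1) ^ 2 * L * εs) ^ 2 + 1)))))) + 1) * (4 / γ * (2 * (8 / γ) + (8 / γ + 4 / γ) + 2 * ((8 / γ + 4 / γ * Real.sqrt (M / Real.sqrt κ₁)) + 4 / γ) + a * (Mφ' * Mφ * Real.exp (Real.sqrt ((L : ℝ) ^ d) * (Real.sqrt (2 * d) * (102 * (d + 1) ^ 2 * L)) * (εs / (1 - ϱ)))) * (4 / γ) + a * ((Mφ' * Mφ * Real.exp (Real.sqrt ((L : ℝ) ^ d) * (Real.sqrt (2 * d) * (102 * (d + 1) ^ 2 * L)) * (εs / (1 - ϱ)))) + 1) * (4 / γ))) + (15 * ((2 * (Mφ * Mφ') * Real.sqrt d + 2 * M + 1) * (4 / γ' + M * ((4 / γ') ^ 2 * (3 + a' * (2 * M + 1))))) / Real.sqrt κ₁) * ((8 / γ + 4 / γ * Real.sqrt (M / Real.sqrt κ₁)) * ((8 / γ + 4 / γ * Real.sqrt (M / Real.sqrt κ₁)) + 4 / γ)) + 8 * pK0 * (4 / γ) ^ 2))))))))))) :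
    r ≤ 1 / 4 ∧ r ≤ 1 / (2 * (d : ℝ) + 1) ∧ r ≤ 1 / (4 * (Mφ * Mφ') * (d * Real.sqrt d) + 4 * (Mφ * Mφ') * d + 2 * (Mφ * Mφ') * Real.sqrt d + Mφ' * Mφ * (Real.exp 1 * Real.exp (Real.sqrt ((L : ℝ) ^ d) * (Real.sqrt (2 * d) * (102 * (d + 1) ^ 2 * L)) * (εs / (1 - ϱ))) * (Real.sqrt ((L : ℝ) ^ d) * ((3 * 1 + (2 * d + 1) * 1) * (2 * Real.sqrt (2 * (2 * d * (102 * (d + 1) ^ 2 * L * εs) ^ 2 + 1)))))) + 1) ∧ r ≤ 1 / (Real.sqrt ((L : ℝ) ^ d) * ((3 * 1 + (2 * d + 1) * 1) * (2 * Real.sqrt (2 * (2 * d * (102 * (d + 1) ^ 2 * L * εs) ^ 2 + 1))))) ∧ r ≤ 1 / (2 * (Mφ * Mφ') * Real.sqrt d + 2 * M + 1) ∧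
      r ≤ γ' / (12 * (1 + a') * (2 * (Mφ * Mφ') * Real.sqrt d + 2 * M + 1)) ∧ r ≤ Real.sqrt κ₁ / (120 * ((2 * (Mφ * Mφ') * Real.sqrt d + 2 * M + 1) * (4 / γ' + M * ((4 / γ') ^ 2 * (3 + a' * (2 * M + 1)))))) ∧ r ≤ (γ / 4 - pK0 / 2) / ((21 + 3 * a) * (4 * (Mφ * Mφ') * (d * Real.sqrt d) + 4 * (Mφ * Mφ') * d + 2 * (Mφ * Mφ') * Real.sqrt d + Mφ' * Mφ * (Real.exp 1 * Real.exp (Real.sqrt ((L : ℝ) ^ d) * (Real.sqrt (2 * d) * (102 * (d + 1) ^ 2 * L)) * (εs / (1 - ϱ))) * (Real.sqrt ((L : ℝ) ^ d) * ((3 * 1 + (2 * d + 1) * 1) * (2 * Real.sqrt (2 * (2 * d * (102 * (d + 1) ^ 2 * L * εs) ^ 2 + 1)))))) + 1) + 4 * (4 * (Mφ * Mφ') * (d * Real.sqrt d) + 4 * (Mφ * Mφ') * d + 2 * (Mφ * Mφ') * Real.sqrt d + Mφ' * Mφ * (Real.exp 1 * Real.exp (Real.sqrt ((L : ℝ) ^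 d) * (Real.sqrt (2 * d) * (102 * (d + 1) ^ 2 * L)) * (εs / (1 - ϱ))) * (Real.sqrt ((L : ℝ) ^ d) * ((3 * 1 + (2 * d + 1) * 1) * (2 * Real.sqrt (2 * (2 * d * (102 * (d + 1) ^ 2 * L * εs) ^ 2 + 1)))))) + 1) * Real.sqrt (M / Real.sqrt κ₁) + 2 * (15 * ((2 * (Mφ * Mφ') * Real.sqrt d + 2 * M + 1) * (4 / γ' + M * ((4 / γ') ^ 2 * (3 + a' * (2 * M + 1))))) / Real.sqrt κ₁) * Real.sqrt (M / Real.sqrt κ₁) ^ 2 + 8 * pK0) ∧ r ≤ (μ₁ / 2) / ((4 * (Mφ * Mφ') * (d * Real.sqrt d) + 4 * (Mφ * Mφ') * d + 2 * (Mφ * Mφ') * Real.sqrt d + Mφ' * Mφ * (Real.exp 1 * Real.exp (Real.sqrt ((L : ℝ) ^ d) * (Real.sqrt (2 * d) * (102 * (d + 1) ^ 2 * L)) * (εs / (1 - ϱ))) * (Real.sqrt ((L : ℝ) ^ d) * ((3 * 1 + (2 * d + 1) * 1) * (2 * Real.sqrt (2 * (2 * d * (102 * (d + 1) ^ 2 *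 L * εs) ^ 2 + 1)))))) + 1) * (4 / γ) * (2 * (Mφ' * Mφ * Real.exp (Real.sqrt ((L : ℝ) ^ d) * (Real.sqrt (2 * d) * (102 * (d + 1) ^ 2 * L)) * (εs / (1 - ϱ)))) + 1) + (Mφ' * Mφ * Real.exp (Real.sqrt ((L : ℝ) ^ d) * (Real.sqrt (2 * d) * (102 * (d + 1) ^ 2 * L)) * (εs / (1 - ϱ)))) * ((Mφ' * Mφ * Real.exp (Real.sqrt ((L : ℝ) ^ d) * (Real.sqrt (2 * d) * (102 * (d + 1) ^ 2 * L)) * (εs / (1 - ϱ)))) + 1) * ((4 * (Mφ * Mφ') * (d * Real.sqrt d) + 4 * (Mφ * Mφ') * d + 2 * (Mφ * Mφ') * Real.sqrt d + Mφ' * Mφ * (Real.exp 1 * Real.exp (Real.sqrt ((L : ℝ) ^ d) * (Real.sqrt (2 * d) * (102 * (d + 1) ^ 2 * L)) * (εs / (1 - ϱ))) * (Real.sqrt ((L : ℝ) ^ d) * ((3 * 1 + (2 * d + 1) * 1) * (2 * Real.sqrt (2 * (2 * d * (102 * (d + 1) ^ 2 * L * εs) ^ 2 + 1)))))) + 1)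 * (4 / γ * (2 * (8 / γ) + (8 / γ + 4 / γ) + 2 * ((8 / γ + 4 / γ * Real.sqrt (M / Real.sqrt κ₁)) + 4 / γ) + a * (Mφ' * Mφ * Real.exp (Real.sqrt ((L : ℝ) ^ d) * (Real.sqrt (2 * d) * (102 * (d + 1) ^ 2 * L)) * (εs / (1 - ϱ)))) * (4 / γ) + a * ((Mφ' * Mφ * Real.exp (Real.sqrt ((L : ℝ) ^ d) * (Real.sqrt (2 * d) * (102 * (d + 1) ^ 2 * L)) * (εs / (1 - ϱ)))) + 1) * (4 / γ))) + (15 * ((2 * (Mφ * Mφ') * Real.sqrt d + 2 * M + 1) * (4 / γ' + M * ((4 / γ') ^ 2 * (3 + a' * (2 * M + 1))))) / Real.sqrt κ₁) * ((8 / γ + 4 / γ * Real.sqrt (M / Real.sqrt κ₁)) * ((8 / γ + 4 / γ * Real.sqrt (M / Real.sqrt κ₁)) + 4 / γ)) + 8 * pK0 * (4 / γ) ^ 2)) := by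
  simp only [le_min_iff] at h
  exact ⟨h.1, h.2.1, h.2.2.1, h.2.2.2.1, h.2.2.2.2.1, h.2.2.2.2.2.1, h.2.2.2.2.2.2.1, h.2.2.2.2.2.2.2.1, h.2.2.2.2.2.2.2.2⟩

/-- **THE `η`-WINDOWS at `ℓ = ℓ′ = 1`**: on the diagonal `ηL^{n+1} = 1` (`1 ≤ L`), `r ≤ 1∕4` and `r ≤ 1∕(2d+1)` give `r·1·η ≤ 1`, `r(3·1 + L^{n+1}(1·η)) ≤ 1`,
`r(2dL^n(1·η)) ≤ 1`, `r·1 ≤ 1` — the windows `hwin`, `hwin0`, `hwin1`, `hwin′` of `B9Eq3126H1BlockDecayTowerClosed`. [folklore]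
[cite: Balaban1985BackgroundPropagators, (3.15) p.393, (3.49) p.399] -/
theorem eta_windows (hL : 1 ≤ L) (n : ℕ) {η : ℝ} (hη : 0 < η) (hηL : η * (L : ℝ) ^ (n + 1) = 1) {r : ℝ} (hr : 0 ≤ r) (h1 : r ≤ 1 / 4)
    (h2 : r ≤ 1 / (2 * (d : ℝ) + 1)) :
    r * 1 * η ≤ 1 ∧ r * (3 * 1 + (L : ℝ) ^ (n + 1) * (1 * η)) ≤ 1 ∧ r * (2 * d * (L : ℝ) ^ n * (1 * η)) ≤ 1 ∧ r * 1 ≤ 1 := by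
  have hL1 : (1 : ℝ) ≤ L := by exact_mod_cast hL
  have hLn : (1 : ℝ) ≤ (L : ℝ) ^ (n + 1) := one_le_pow₀ hL1
  have hη1 : η ≤ 1 := by nlinarith
  have hLnη : (L : ℝ) ^ n * η ≤ 1 := by
    have h : (L : ℝ) ^ n * η * L = 1 := by rw [mul_assoc, mul_comm η, ← mul_assoc, ← pow_succ, mul_comm, hηL]
    have h0 : 0 ≤ (L : ℝ) ^ n * η := by positivity
    nlinarith
  have hr4 : r ≤ 1 / 4 := h1
  have h2d : r * (2 * d) ≤ 1 := by
    have hd0 : (0 : ℝ) < 2 * (d : ℝ) + 1 := by positivity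
    rw [le_div_iff₀ hd0] at h2
    nlinarith
  refine ⟨by nlinarith, ?_, ?_, by linarith⟩
  · rw [show (L : ℝ) ^ (n + 1) * (1 * η) = η * (L : ℝ) ^ (n + 1) by ring, hηL]; linarith
  · calc r * (2 * d * (L : ℝ) ^ n * (1 * η)) = r * (2 * d) * ((L : ℝ) ^ n * η) := by ring
      _ ≤ 1 * 1 := mul_le_mul h2d hLnη (by positivity) zero_le_one
      _ = 1 := one_mul 1

/-- **THE UNIT WINDOWS**: from the ratio bounds 3–7 — `β := N_β r ≤ 1`, `β′ := N′r ≤ 1`, `3(1+a′)β′² ≤ γ′∕4` (`small′`), `12·X ≤ √κ₁` (`hwinκ`),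
`ρ := (6X + 9X)∕√κ₁ ≤ 1∕8` with `X = β′(4∕γ′ + M(4∕γ′)²(3 + a′(2M+1)))`, and the tower `dQ` window `√(L^d)·r·N_T ≤ 1`. [folklore]
[cite: Balaban1985BackgroundPropagators, (3.49) p.399, Thm 3.11 p.416] -/
theorem unit_windows (hL : 1 ≤ L) (hMφ : 0 ≤ Mφ) (hMφ' : 0 ≤ Mφ') (ha' : 0 ≤ a') (hγ' : 0 < γ') (hκ₁ : 0 < κ₁) (hM : 0 ≤ M)
    {r : ℝ} (hr : 0 ≤ r) (h3 : r ≤ 1 / (4 * (Mφ * Mφ') * (d * Real.sqrt d) + 4 * (Mφ * Mφ') * d + 2 * (Mφ * Mφ') * Real.sqrt d + Mφ' * Mφ * (Real.exp 1 * Real.exp (Real.sqrt ((L : ℝ) ^ d) * (Real.sqrt (2 * d) * (102 * (d + 1) ^ 2 * L)) * (εs / (1 - ϱ))) * (Real.sqrt ((L : ℝ) ^ d) * ((3 * 1 + (2 * d + 1) * 1) * (2 * Real.sqrt (2 * (2 * d * (102 * (d + 1) ^ 2 * L * εs) ^ 2 + 1)))))) + 1)) (h4 : r ≤ 1 / (Real.sqrt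 ((L : ℝ) ^ d) * ((3 * 1 + (2 * d + 1) * 1) * (2 * Real.sqrt (2 * (2 * d * (102 * (d + 1) ^ 2 * L * εs) ^ 2 + 1)))))) (h5 : r ≤ 1 / (2 * (Mφ * Mφ') * Real.sqrt d + 2 * M + 1))
    (h6 : r ≤ γ' / (12 * (1 + a') * (2 * (Mφ * Mφ') * Real.sqrt d + 2 * M + 1))) (h7 : r ≤ Real.sqrt κ₁ / (120 * ((2 * (Mφ * Mφ') * Real.sqrt d + 2 * M + 1) * (4 / γ' + M * ((4 / γ') ^ 2 * (3 + a' * (2 * M + 1))))))) :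
    0 ≤ (4 * (Mφ * Mφ') * (d * Real.sqrt d) + 4 * (Mφ * Mφ') * d + 2 * (Mφ * Mφ') * Real.sqrt d + Mφ' * Mφ * (Real.exp 1 * Real.exp (Real.sqrt ((L : ℝ) ^ d) * (Real.sqrt (2 * d) * (102 * (d + 1) ^ 2 * L)) * (εs / (1 - ϱ))) * (Real.sqrt ((L : ℝ) ^ d) * ((3 * 1 + (2 * d + 1) * 1) * (2 * Real.sqrt (2 * (2 * d * (102 * (d + 1) ^ 2 * L * εs) ^ 2 + 1)))))) + 1) * r ∧ (4 * (Mφ * Mφ') * (d * Real.sqrt d) + 4 * (Mφ * Mφ') * d + 2 * (Mφ * Mφ') * Real.sqrt d + Mφ' * Mφ * (Real.exp 1 * Real.exp (Real.sqrt ((L : ℝ) ^ d) * (Real.sqrt (2 * d) * (102 * (d + 1) ^ 2 * L)) * (εs / (1 - ϱ))) * (Real.sqrt ((L : ℝ) ^ d) * ((3 * 1 + (2 * d + 1) * 1) * (2 * Real.sqrt (2 * (2 * d * (102 * (d + 1) ^ 2 * L * εs) ^ 2 + 1)))))) + 1) * r ≤ 1 ∧ 0 ≤ (2 * (Mφ *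 Mφ') * Real.sqrt d + 2 * M + 1) * r ∧ (2 * (Mφ * Mφ') * Real.sqrt d + 2 * M + 1) * r ≤ 1 ∧
      3 * (1 + a') * ((2 * (Mφ * Mφ') * Real.sqrt d + 2 * M + 1) * r) ^ 2 ≤ γ' / 4 ∧
      12 * ((2 * (Mφ * Mφ') * Real.sqrt d + 2 * M + 1) * r * (4 / γ' + M * ((4 / γ') ^ 2 * (3 + a' * (2 * M + 1))))) ≤ Real.sqrt κ₁ ∧
      0 ≤ (6 * ((2 * (Mφ * Mφ') * Real.sqrt d + 2 * M + 1) * r * (4 / γ' + M * ((4 / γ') ^ 2 * (3 + a' * (2 * M + 1))))) + 9 * ((2 * (Mφ * Mφ') * Real.sqrt d + 2 * M + 1) * r * (4 / γ' + M * ((4 / γ') ^ 2 * (3 + a' * (2 * M + 1)))))) / Real.sqrt κ₁ ∧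
      (6 * ((2 * (Mφ * Mφ') * Real.sqrt d + 2 * M + 1) * r * (4 / γ' + M * ((4 / γ') ^ 2 * (3 + a' * (2 * M + 1))))) + 9 * ((2 * (Mφ * Mφ') * Real.sqrt d + 2 * M + 1) * r * (4 / γ' + M * ((4 / γ') ^ 2 * (3 + a' * (2 * M + 1)))))) / Real.sqrt κ₁ ≤ 1 / 8 ∧
      Real.sqrt ((L : ℝ) ^ d) * r * ((3 * 1 + (2 * d + 1) * 1) * (2 * Real.sqrt (2 * (2 * d * (102 * (d + 1) ^ 2 * L * εs) ^ 2 + 1)))) ≤ 1 := by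
  have hL0 : (0 : ℝ) < L := by exact_mod_cast (lt_of_lt_of_le zero_lt_one hL)
  have hsq : 0 < Real.sqrt κ₁ := Real.sqrt_pos.mpr hκ₁
  have hS : 0 < Real.sqrt (2 * (2 * d * (102 * (d + 1) ^ 2 * L * εs) ^ 2 + 1)) := Real.sqrt_pos.mpr (by positivity)
  have hLd : 0 < Real.sqrt ((L : ℝ) ^ d) := Real.sqrt_pos.mpr (by positivity)
  have hNB : 0 < (4 * (Mφ * Mφ') * (d * Real.sqrt d) + 4 * (Mφ * Mφ') * d + 2 * (Mφ * Mφ') * Real.sqrt d + Mφ' * Mφ * (Real.exp 1 * Real.exp (Real.sqrt ((L : ℝ) ^ d) * (Real.sqrt (2 * d) * (102 * (d + 1) ^ 2 * L)) * (εs / (1 - ϱ))) * (Real.sqrt ((L : ℝ) ^ d) * ((3 * 1 + (2 * d + 1) * 1) * (2 * Real.sqrt (2 * (2 * d * (102 * (d + 1) ^ 2 * L * εs) ^ 2 + 1)))))) + 1) := by positivity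
  have hNP : 0 < (2 * (Mφ * Mφ') * Real.sqrt d + 2 * M + 1) := by positivity
  have hX0 : 0 < (4 / γ' + M * ((4 / γ') ^ 2 * (3 + a' * (2 * M + 1)))) := by positivity
  rw [le_div_iff₀ hNB] at h3
  rw [le_div_iff₀ (by positivity)] at h4
  rw [le_div_iff₀ hNP] at h5
  rw [le_div_iff₀ (by positivity)] at h6
  rw [le_div_iff₀ (by positivity)] at h7
  have hβ'1 : (2 * (Mφ * Mφ') * Real.sqrt d + 2 * M + 1) * r ≤ 1 := by linarith
  have hβ'0 : 0 ≤ (2 * (Mφ * Mφ') * Real.sqrt d + 2 * M + 1) * r := by positivity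
  have h12 : 12 * ((2 * (Mφ * Mφ') * Real.sqrt d + 2 * M + 1) * r * (4 / γ' + M * ((4 / γ') ^ 2 * (3 + a' * (2 * M + 1))))) ≤ Real.sqrt κ₁ := by
    have hx : 12 * ((2 * (Mφ * Mφ') * Real.sqrt d + 2 * M + 1) * r * (4 / γ' + M * ((4 / γ') ^ 2 * (3 + a' * (2 * M + 1))))) = (r * (120 * ((2 * (Mφ * Mφ') * Real.sqrt d + 2 * M + 1) * (4 / γ' + M * ((4 / γ') ^ 2 * (3 + a' * (2 * M + 1))))))) / 10 := by ring
    rw [hx]; linarith [hsq.le]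
  refine ⟨by positivity, by linarith, hβ'0, hβ'1, ?_, h12, by positivity, ?_, by linarith⟩
  · have hsq1 : ((2 * (Mφ * Mφ') * Real.sqrt d + 2 * M + 1) * r) ^ 2 ≤ (2 * (Mφ * Mφ') * Real.sqrt d + 2 * M + 1) * r := by nlinarith
    have ha1 : (0 : ℝ) ≤ 3 * (1 + a') := by positivity
    nlinarith [mul_le_mul_of_nonneg_left hsq1 ha1]
  · rw [div_le_iff₀ hsq]
    have hx : 6 * ((2 * (Mφ * Mφ') * Real.sqrt d + 2 * M + 1) * r * (4 / γ' + M * ((4 / γ') ^ 2 * (3 + a' * (2 * M + 1))))) + 9 * ((2 * (Mφ * Mφ') * Real.sqrt d + 2 * M + 1) * r * (4 / γ' + M * ((4 / γ') ^ 2 * (3 + a' * (2 * M + 1))))) = (r * (120 * ((2 * (Mφ * Mφ') * Real.sqrt d + 2 * M + 1) * (4 / γ' + M * ((4 / γ') ^ 2 * (3 + a' * (2 * M + 1))))))) / 8 := by ring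
    rw [hx]; linarith

/-- **THE SLOPES**: at `β := N_β r`, `β′ := N′r` each linear side condition of the `H₁` tower row holds — `hβCC`, `hβC`, `hβD` (and the tower `dQ` slope),
`hβ′D`, `hβ′Q`, `0 ≤ β_K := 8p_K⁰r`. [folklore] [cite: Balaban1985BackgroundPropagators, (3.49) p.399] -/
theorem slopes_le (hMφ : 0 ≤ Mφ) (hMφ' : 0 ≤ Mφ') (hM : 0 ≤ M) (hpK0 : 0 ≤ pK0) {r : ℝ} (hr : 0 ≤ r) :
    4 * r * 1 * (Mφ * Mφ') * (d * Real.sqrt d) ≤ (4 * (Mφ * Mφ') * (d * Real.sqrt d) + 4 * (Mφ * Mφ') * d + 2 * (Mφ * Mφ') * Real.sqrt d + Mφ' * Mφ * (Real.exp 1 * Real.exp (Real.sqrt ((L : ℝ) ^ d) * (Real.sqrt (2 * d) * (102 * (d + 1) ^ 2 * L)) * (εs / (1 - ϱ))) * (Real.sqrt ((L : ℝ) ^ d) * ((3 * 1 + (2 * d + 1) * 1) * (2 * Real.sqrt (2 * (2 * d * (102 * (d + 1) ^ 2 * L * εs) ^ 2 + 1)))))) + 1) * r ∧ 4 * r * 1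 * (Mφ * Mφ') * d ≤ (4 * (Mφ * Mφ') * (d * Real.sqrt d) + 4 * (Mφ * Mφ') * d + 2 * (Mφ * Mφ') * Real.sqrt d + Mφ' * Mφ * (Real.exp 1 * Real.exp (Real.sqrt ((L : ℝ) ^ d) * (Real.sqrt (2 * d) * (102 * (d + 1) ^ 2 * L)) * (εs / (1 - ϱ))) * (Real.sqrt ((L : ℝ) ^ d) * ((3 * 1 + (2 * d + 1) * 1) * (2 * Real.sqrt (2 * (2 * d * (102 * (d + 1) ^ 2 * L * εs) ^ 2 + 1)))))) + 1) * r ∧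
      2 * r * 1 * (Mφ * Mφ') * Real.sqrt d ≤ (4 * (Mφ * Mφ') * (d * Real.sqrt d) + 4 * (Mφ * Mφ') * d + 2 * (Mφ * Mφ') * Real.sqrt d + Mφ' * Mφ * (Real.exp 1 * Real.exp (Real.sqrt ((L : ℝ) ^ d) * (Real.sqrt (2 * d) * (102 * (d + 1) ^ 2 * L)) * (εs / (1 - ϱ))) * (Real.sqrt ((L : ℝ) ^ d) * ((3 * 1 + (2 * d + 1) * 1) * (2 * Real.sqrt (2 * (2 * d * (102 * (d + 1) ^ 2 * L * εs) ^ 2 + 1)))))) + 1) * r ∧ Mφ' * Mφ * ((Real.exp 1 * Real.exp (Real.sqrt ((L : ℝ) ^ d) * (Real.sqrt (2 * d) * (102 * (d + 1) ^ 2 * L)) * (εs / (1 - ϱ))) * (Real.sqrt ((L : ℝ) ^ d) * ((3 * 1 + (2 * d + 1) * 1) * (2 * Real.sqrt (2 * (2 * d * (102 * (d + 1) ^ 2 * L * εs) ^ 2 + 1)))))) * r) ≤ (4 * (Mφ * Mφ') * (d * Real.sqrt d) + 4 * (Mφ * Mφ') * d + 2 * (Mφ * Mφ') * Real.sqrt d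 + Mφ' * Mφ * (Real.exp 1 * Real.exp (Real.sqrt ((L : ℝ) ^ d) * (Real.sqrt (2 * d) * (102 * (d + 1) ^ 2 * L)) * (εs / (1 - ϱ))) * (Real.sqrt ((L : ℝ) ^ d) * ((3 * 1 + (2 * d + 1) * 1) * (2 * Real.sqrt (2 * (2 * d * (102 * (d + 1) ^ 2 * L * εs) ^ 2 + 1)))))) + 1) * r ∧
      2 * r * 1 * (Mφ * Mφ') * Real.sqrt d ≤ (2 * (Mφ * Mφ') * Real.sqrt d + 2 * M + 1) * r ∧ 2 * r * 1 * M ≤ (2 * (Mφ * Mφ') * Real.sqrt d + 2 * M + 1) * r ∧ 0 ≤ 8 * pK0 * r := by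
  have h1 : 0 ≤ 4 * (Mφ * Mφ') * (d * Real.sqrt d) := by positivity
  have h2 : 0 ≤ 4 * (Mφ * Mφ') * (d : ℝ) := by positivity
  have h3 : 0 ≤ 2 * (Mφ * Mφ') * Real.sqrt d := by positivity
  have h4 : 0 ≤ Mφ' * Mφ * (Real.exp 1 * Real.exp (Real.sqrt ((L : ℝ) ^ d) * (Real.sqrt (2 * d) * (102 * (d + 1) ^ 2 * L)) * (εs / (1 - ϱ))) * (Real.sqrt ((L : ℝ) ^ d) * ((3 * 1 + (2 * d + 1) * 1) * (2 * Real.sqrt (2 * (2 * d * (102 * (d + 1) ^ 2 * L * εs) ^ 2 + 1)))))) := by positivity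
  have h5 : 0 ≤ 2 * M := by positivity
  refine ⟨?_, ?_, ?_, ?_, ?_, ?_, by positivity⟩
  · calc 4 * r * 1 * (Mφ * Mφ') * (d * Real.sqrt d) = (4 * (Mφ * Mφ') * (d * Real.sqrt d)) * r := by ring
      _ ≤ _ := mul_le_mul_of_nonneg_right (by linarith) hr
  · calc 4 * r * 1 * (Mφ * Mφ') * d = (4 * (Mφ * Mφ') * (d : ℝ)) * r := by ring
      _ ≤ _ := mul_le_mul_of_nonneg_right (by linarith) hr
  · calc 2 * r * 1 * (Mφ * Mφ') * Real.sqrt d = (2 * (Mφ * Mφ') * Real.sqrt d) * r := by ring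
      _ ≤ _ := mul_le_mul_of_nonneg_right (by linarith) hr
  · calc Mφ' * Mφ * ((Real.exp 1 * Real.exp (Real.sqrt ((L : ℝ) ^ d) * (Real.sqrt (2 * d) * (102 * (d + 1) ^ 2 * L)) * (εs / (1 - ϱ))) * (Real.sqrt ((L : ℝ) ^ d) * ((3 * 1 + (2 * d + 1) * 1) * (2 * Real.sqrt (2 * (2 * d * (102 * (d + 1) ^ 2 * L * εs) ^ 2 + 1)))))) * r) = (Mφ' * Mφ * (Real.exp 1 * Real.exp (Real.sqrt ((L : ℝ) ^ d) * (Real.sqrt (2 * d) * (102 * (d + 1) ^ 2 * L)) * (εs / (1 - ϱ))) * (Real.sqrt ((L : ℝ) ^ d) * ((3 * 1 + (2 * d + 1) * 1) * (2 * Real.sqrt (2 * (2 * d * (102 * (d + 1) ^ 2 * L * εs) ^ 2 + 1))))))) * r := by ring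
      _ ≤ _ := mul_le_mul_of_nonneg_right (by linarith) hr
  · calc 2 * r * 1 * (Mφ * Mφ') * Real.sqrt d = (2 * (Mφ * Mφ') * Real.sqrt d) * r := by ring
      _ ≤ _ := mul_le_mul_of_nonneg_right (by linarith) hr
  · calc 2 * r * 1 * M = (2 * M) * r := by ring
      _ ≤ _ := mul_le_mul_of_nonneg_right (by linarith) hr

set_option maxHeartbeats 400000 in
/-- **THE `small` WINDOW OF THE `G₁` BLOCK DECAY, CLOSED**: with `β = N_βr ≤ 1`, `ρ = (6X + 9X)∕√κ₁`, `β_K = 8p_K⁰r`, `C_P = √(M∕√κ₁)` and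
`r ≤ (γ∕4 − p_K⁰∕2)∕S₁`: `p_K⁰∕2 + (21 + 3a)β² + 4βC_P + 2ρC_P² + β_K ≤ γ∕4`. [folklore] [cite: Balaban1985BackgroundPropagators, Thm 3.11 p.416, (3.49) p.399] -/
theorem small_window (hL : 1 ≤ L) (hMφ : 0 ≤ Mφ) (hMφ' : 0 ≤ Mφ') (ha : 0 ≤ a) (ha' : 0 ≤ a') (hγ' : 0 < γ') (hκ₁ : 0 < κ₁) (hM : 0 ≤ M)
    (hpK0 : 0 ≤ pK0) {r : ℝ} (hr : 0 ≤ r) (h3 : r ≤ 1 / (4 * (Mφ * Mφ') * (d * Real.sqrt d) + 4 * (Mφ * Mφ') * d + 2 * (Mφ * Mφ') * Real.sqrt d + Mφ' * Mφ * (Real.exp 1 * Real.exp (Real.sqrt ((L : ℝ) ^ d) * (Real.sqrt (2 * d) * (102 * (d + 1) ^ 2 * L)) * (εs / (1 - ϱ))) * (Real.sqrt ((L : ℝ) ^ d) * ((3 * 1 + (2 * d + 1) * 1) * (2 * Real.sqrt (2 * (2 * d * (102 * (d + 1) ^ 2 * L * εs) ^ 2 + 1)))))) + 1)) (h8 : r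 ≤ (γ / 4 - pK0 / 2) / ((21 + 3 * a) * (4 * (Mφ * Mφ') * (d * Real.sqrt d) + 4 * (Mφ * Mφ') * d + 2 * (Mφ * Mφ') * Real.sqrt d + Mφ' * Mφ * (Real.exp 1 * Real.exp (Real.sqrt ((L : ℝ) ^ d) * (Real.sqrt (2 * d) * (102 * (d + 1) ^ 2 * L)) * (εs / (1 - ϱ))) * (Real.sqrt ((L : ℝ) ^ d) * ((3 * 1 + (2 * d + 1) * 1) * (2 * Real.sqrt (2 * (2 * d * (102 * (d + 1) ^ 2 * L * εs) ^ 2 + 1)))))) + 1) + 4 * (4 * (Mφ * Mφ') * (d * Real.sqrt d) + 4 * (Mφ * Mφ') * d + 2 * (Mφ * Mφ') * Real.sqrt d + Mφ' * Mφ * (Real.exp 1 * Real.exp (Real.sqrt ((L : ℝ) ^ d) * (Real.sqrt (2 * d) * (102 * (d + 1) ^ 2 * L)) * (εs / (1 - ϱ))) * (Real.sqrt ((L : ℝ) ^ d) * ((3 * 1 + (2 * d + 1) * 1) * (2 * Real.sqrt (2 * (2 * d * (102 * (d + 1) ^ 2 * L * εs) ^ 2 + 1)))))) + 1) * Real.sqrt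 (M / Real.sqrt κ₁) + 2 * (15 * ((2 * (Mφ * Mφ') * Real.sqrt d + 2 * M + 1) * (4 / γ' + M * ((4 / γ') ^ 2 * (3 + a' * (2 * M + 1))))) / Real.sqrt κ₁) * Real.sqrt (M / Real.sqrt κ₁) ^ 2 + 8 * pK0)) :
    pK0 / 2 + (21 + 3 * a) * ((4 * (Mφ * Mφ') * (d * Real.sqrt d) + 4 * (Mφ * Mφ') * d + 2 * (Mφ * Mφ') * Real.sqrt d + Mφ' * Mφ * (Real.exp 1 * Real.exp (Real.sqrt ((L : ℝ) ^ d) * (Real.sqrt (2 * d) * (102 * (d + 1) ^ 2 * L)) * (εs / (1 - ϱ))) * (Real.sqrt ((L : ℝ) ^ d) * ((3 * 1 + (2 * d + 1) * 1) * (2 * Real.sqrt (2 * (2 * d * (102 * (d + 1) ^ 2 * L * εs) ^ 2 + 1)))))) + 1) * r) ^ 2 + 4 * ((4 * (Mφ * Mφ') * (d * Real.sqrt d) + 4 * (Mφ * Mφ') * d + 2 * (Mφ * Mφ') * Real.sqrt d + Mφ' * Mφ * (Real.exp 1 * Real.exp (Real.sqrt ((L : ℝ) ^ d) * (Real.sqrt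 (2 * d) * (102 * (d + 1) ^ 2 * L)) * (εs / (1 - ϱ))) * (Real.sqrt ((L : ℝ) ^ d) * ((3 * 1 + (2 * d + 1) * 1) * (2 * Real.sqrt (2 * (2 * d * (102 * (d + 1) ^ 2 * L * εs) ^ 2 + 1)))))) + 1) * r) * Real.sqrt (M / Real.sqrt κ₁) +
      2 * ((6 * ((2 * (Mφ * Mφ') * Real.sqrt d + 2 * M + 1) * r * (4 / γ' + M * ((4 / γ') ^ 2 * (3 + a' * (2 * M + 1))))) + 9 * ((2 * (Mφ * Mφ') * Real.sqrt d + 2 * M + 1) * r * (4 / γ' + M * ((4 / γ') ^ 2 * (3 + a' * (2 * M + 1)))))) / Real.sqrt κ₁) * Real.sqrt (M / Real.sqrt κ₁) ^ 2 + 8 * pK0 * r ≤ γ / 4 := by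
  have hL0 : (0 : ℝ) < L := by exact_mod_cast (lt_of_lt_of_le zero_lt_one hL)
  have hsq : 0 < Real.sqrt κ₁ := Real.sqrt_pos.mpr hκ₁
  have hS : 0 < Real.sqrt (2 * (2 * d * (102 * (d + 1) ^ 2 * L * εs) ^ 2 + 1)) := Real.sqrt_pos.mpr (by positivity)
  have hLd : 0 < Real.sqrt ((L : ℝ) ^ d) := Real.sqrt_pos.mpr (by positivity)
  have hNB : 0 < (4 * (Mφ * Mφ') * (d * Real.sqrt d) + 4 * (Mφ * Mφ') * d + 2 * (Mφ * Mφ') * Real.sqrt d + Mφ' * Mφ * (Real.exp 1 * Real.exp (Real.sqrt ((L : ℝ) ^ d) * (Real.sqrt (2 * d) * (102 * (d + 1) ^ 2 * L)) * (εs / (1 - ϱ))) * (Real.sqrt ((L : ℝ) ^ d) * ((3 * 1 + (2 * d + 1) * 1) * (2 * Real.sqrt (2 * (2 * d * (102 * (d + 1) ^ 2 * L * εs) ^ 2 + 1)))))) + 1) := by positivity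
  have hNP : 0 < (2 * (Mφ * Mφ') * Real.sqrt d + 2 * M + 1) := by positivity
  have hX0 : 0 < (4 / γ' + M * ((4 / γ') ^ 2 * (3 + a' * (2 * M + 1)))) := by positivity
  have hCP : 0 ≤ Real.sqrt (M / Real.sqrt κ₁) := Real.sqrt_nonneg _
  have hS1 : 0 < ((21 + 3 * a) * (4 * (Mφ * Mφ') * (d * Real.sqrt d) + 4 * (Mφ * Mφ') * d + 2 * (Mφ * Mφ') * Real.sqrt d + Mφ' * Mφ * (Real.exp 1 * Real.exp (Real.sqrt ((L : ℝ) ^ d) * (Real.sqrt (2 * d) * (102 * (d + 1) ^ 2 * L)) * (εs / (1 - ϱ))) * (Real.sqrt ((L : ℝ) ^ d) * ((3 * 1 + (2 * d + 1) * 1) * (2 * Real.sqrt (2 * (2 * d * (102 * (d + 1) ^ 2 * L * εs) ^ 2 + 1)))))) + 1) + 4 * (4 * (Mφ * Mφ') * (d * Real.sqrt d) + 4 * (Mφ * Mφ') * d + 2 * (Mφ * Mφ') * Real.sqrt d + Mφ' * Mφ * (Real.exp 1 * Real.exp (Real.sqrt ((L : ℝ) ^ d) * (Real.sqrt (2 *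 d) * (102 * (d + 1) ^ 2 * L)) * (εs / (1 - ϱ))) * (Real.sqrt ((L : ℝ) ^ d) * ((3 * 1 + (2 * d + 1) * 1) * (2 * Real.sqrt (2 * (2 * d * (102 * (d + 1) ^ 2 * L * εs) ^ 2 + 1)))))) + 1) * Real.sqrt (M / Real.sqrt κ₁) + 2 * (15 * ((2 * (Mφ * Mφ') * Real.sqrt d + 2 * M + 1) * (4 / γ' + M * ((4 / γ') ^ 2 * (3 + a' * (2 * M + 1))))) / Real.sqrt κ₁) * Real.sqrt (M / Real.sqrt κ₁) ^ 2 + 8 * pK0) := by positivity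
  rw [le_div_iff₀ hNB] at h3
  rw [le_div_iff₀ hS1] at h8
  set x : ℝ := (4 * (Mφ * Mφ') * (d * Real.sqrt d) + 4 * (Mφ * Mφ') * d + 2 * (Mφ * Mφ') * Real.sqrt d + Mφ' * Mφ * (Real.exp 1 * Real.exp (Real.sqrt ((L : ℝ) ^ d) * (Real.sqrt (2 * d) * (102 * (d + 1) ^ 2 * L)) * (εs / (1 - ϱ))) * (Real.sqrt ((L : ℝ) ^ d) * ((3 * 1 + (2 * d + 1) * 1) * (2 * Real.sqrt (2 * (2 * d * (102 * (d + 1) ^ 2 * L * εs) ^ 2 + 1)))))) + 1) * r with hx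
  have hx0 : 0 ≤ x := by positivity
  have hx1 : x ≤ 1 := by rw [hx, mul_comm]; exact h3
  have hsq1 : x ^ 2 ≤ x := by nlinarith [mul_nonneg hx0 (sub_nonneg.2 hx1)]
  have hρ : (6 * ((2 * (Mφ * Mφ') * Real.sqrt d + 2 * M + 1) * r * (4 / γ' + M * ((4 / γ') ^ 2 * (3 + a' * (2 * M + 1))))) + 9 * ((2 * (Mφ * Mφ') * Real.sqrt d + 2 * M + 1) * r * (4 / γ' + M * ((4 / γ') ^ 2 * (3 + a' * (2 * M + 1)))))) / Real.sqrt κ₁ = (15 * ((2 * (Mφ * Mφ') * Real.sqrt d + 2 * M + 1) * (4 / γ' + M * ((4 / γ') ^ 2 * (3 + a' * (2 * M + 1))))) / Real.sqrt κ₁) * r := by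
    field_simp; ring
  rw [hρ]
  have hA : (21 + 3 * a) * x ^ 2 ≤ (21 + 3 * a) * x := mul_le_mul_of_nonneg_left hsq1 (by positivity)
  have hSr : r * ((21 + 3 * a) * (4 * (Mφ * Mφ') * (d * Real.sqrt d) + 4 * (Mφ * Mφ') * d + 2 * (Mφ * Mφ') * Real.sqrt d + Mφ' * Mφ * (Real.exp 1 * Real.exp (Real.sqrt ((L : ℝ) ^ d) * (Real.sqrt (2 * d) * (102 * (d + 1) ^ 2 * L)) * (εs / (1 - ϱ))) * (Real.sqrt ((L : ℝ) ^ d) * ((3 * 1 + (2 * d + 1) * 1) * (2 * Real.sqrt (2 * (2 * d * (102 * (d + 1) ^ 2 * L * εs) ^ 2 + 1)))))) + 1) + 4 * (4 * (Mφ * Mφ') * (d * Real.sqrt d) + 4 * (Mφ * Mφ') * d + 2 * (Mφ * Mφ') * Real.sqrt d + Mφ' * Mφ * (Real.exp 1 * Real.exp (Real.sqrt ((L : ℝ) ^ d) * (Real.sqrt (2 * d) * (102 * (d + 1) ^ 2 * L)) * (εs / (1 - ϱ))) * (Real.sqrt ((L : ℝ) ^ d) * ((3 * 1 + (2 * d +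 1) * 1) * (2 * Real.sqrt (2 * (2 * d * (102 * (d + 1) ^ 2 * L * εs) ^ 2 + 1)))))) + 1) * Real.sqrt (M / Real.sqrt κ₁) + 2 * (15 * ((2 * (Mφ * Mφ') * Real.sqrt d + 2 * M + 1) * (4 / γ' + M * ((4 / γ') ^ 2 * (3 + a' * (2 * M + 1))))) / Real.sqrt κ₁) * Real.sqrt (M / Real.sqrt κ₁) ^ 2 + 8 * pK0) = (21 + 3 * a) * x + 4 * x * Real.sqrt (M / Real.sqrt κ₁) + 2 * ((15 * ((2 * (Mφ * Mφ') * Real.sqrt d + 2 * M + 1) * (4 / γ' + M * ((4 / γ') ^ 2 * (3 + a' * (2 * M + 1))))) / Real.sqrt κ₁) * r) * Real.sqrt (M / Real.sqrt κ₁) ^ 2 + 8 * pK0 * r := by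
    rw [hx]; ring
  linarith [hA, hSr, h8]

set_option maxHeartbeats 400000 in
/-- **THE `small2` WINDOW OF THE `(Q_kG₁Q_k†)⁻¹` ROW, CLOSED**: with `β = N_βr`, `ρ = (6X + 9X)∕√κ₁`, `β_K = 8p_K⁰r`, `C_P = √(M∕√κ₁)`,
`C_Q = M_φ′M_φ·exp(√(L^d)√(2d)·102(d+1)²L·ε_s∕(1−ϱ))` and `r ≤ (μ₁∕2)∕S₂`: the second Neumann window `≤ μ₁∕2`. [folklore]
[cite: Balaban1985Variational, (45) p.285; Balaban1985BackgroundPropagators, (3.126) p.420, (3.49) p.399] -/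
theorem small2_window (hL : 1 ≤ L) (hMφ : 0 ≤ Mφ) (hMφ' : 0 ≤ Mφ') (ha : 0 ≤ a) (ha' : 0 ≤ a') (hγ' : 0 < γ') (hκ₁ : 0 < κ₁) (hM : 0 ≤ M)
    (hγ : 0 < γ) (hpK0 : 0 ≤ pK0) {r : ℝ} (h9 : r ≤ (μ₁ / 2) / ((4 * (Mφ * Mφ') * (d * Real.sqrt d) + 4 * (Mφ * Mφ') * d + 2 * (Mφ * Mφ') * Real.sqrt d + Mφ' * Mφ * (Real.exp 1 * Real.exp (Real.sqrt ((L : ℝ) ^ d) * (Real.sqrt (2 * d) * (102 * (d + 1) ^ 2 * L)) * (εs / (1 - ϱ))) * (Real.sqrt ((L : ℝ) ^ d) * ((3 * 1 + (2 * d + 1) * 1) * (2 * Real.sqrt (2 * (2 * d * (102 * (d + 1) ^ 2 * L * εs) ^ 2 + 1)))))) + 1) * (4 / γ) * (2 * (Mφ' * Mφ * Real.exp (Real.sqrt ((L : ℝ) ^ d) * (Real.sqrt (2 * d) * (102 * (d + 1) ^ 2 * L)) * (εs / (1 - ϱ)))) + 1) + (Mφ' * Mφ * Real.exp (Real.sqrt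 ((L : ℝ) ^ d) * (Real.sqrt (2 * d) * (102 * (d + 1) ^ 2 * L)) * (εs / (1 - ϱ)))) * ((Mφ' * Mφ * Real.exp (Real.sqrt ((L : ℝ) ^ d) * (Real.sqrt (2 * d) * (102 * (d + 1) ^ 2 * L)) * (εs / (1 - ϱ)))) + 1) * ((4 * (Mφ * Mφ') * (d * Real.sqrt d) + 4 * (Mφ * Mφ') * d + 2 * (Mφ * Mφ') * Real.sqrt d + Mφ' * Mφ * (Real.exp 1 * Real.exp (Real.sqrt ((L : ℝ) ^ d) * (Real.sqrt (2 * d) * (102 * (d + 1) ^ 2 * L)) * (εs / (1 - ϱ))) * (Real.sqrt ((L : ℝ) ^ d) * ((3 * 1 + (2 * d + 1) * 1) * (2 * Real.sqrt (2 * (2 * d * (102 * (d + 1) ^ 2 * L * εs) ^ 2 + 1)))))) + 1) * (4 / γ * (2 * (8 / γ) + (8 / γ + 4 / γ) + 2 * ((8 / γ + 4 / γ * Real.sqrt (M / Real.sqrt κ₁)) + 4 / γ) + a * (Mφ' * Mφ * Real.exp (Real.sqrt ((L : ℝ) ^ d) * (Real.sqrt (2 * d) * (102 * (d + 1) ^ 2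 * L)) * (εs / (1 - ϱ)))) * (4 / γ) + a * ((Mφ' * Mφ * Real.exp (Real.sqrt ((L : ℝ) ^ d) * (Real.sqrt (2 * d) * (102 * (d + 1) ^ 2 * L)) * (εs / (1 - ϱ)))) + 1) * (4 / γ))) + (15 * ((2 * (Mφ * Mφ') * Real.sqrt d + 2 * M + 1) * (4 / γ' + M * ((4 / γ') ^ 2 * (3 + a' * (2 * M + 1))))) / Real.sqrt κ₁) * ((8 / γ + 4 / γ * Real.sqrt (M / Real.sqrt κ₁)) * ((8 / γ + 4 / γ * Real.sqrt (M / Real.sqrt κ₁)) + 4 / γ)) + 8 * pK0 * (4 / γ) ^ 2))) :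
    (4 * (Mφ * Mφ') * (d * Real.sqrt d) + 4 * (Mφ * Mφ') * d + 2 * (Mφ * Mφ') * Real.sqrt d + Mφ' * Mφ * (Real.exp 1 * Real.exp (Real.sqrt ((L : ℝ) ^ d) * (Real.sqrt (2 * d) * (102 * (d + 1) ^ 2 * L)) * (εs / (1 - ϱ))) * (Real.sqrt ((L : ℝ) ^ d) * ((3 * 1 + (2 * d + 1) * 1) * (2 * Real.sqrt (2 * (2 * d * (102 * (d + 1) ^ 2 * L * εs) ^ 2 + 1)))))) + 1) * r * (4 / γ) * (2 * (Mφ' * Mφ * Real.exp (Real.sqrt ((L : ℝ) ^ d) * (Real.sqrt (2 * d) * (102 * (d + 1) ^ 2 * L)) * (εs / (1 - ϱ)))) + 1) + (Mφ' * Mφ * Real.exp (Real.sqrt ((L : ℝ) ^ d) * (Real.sqrt (2 * d) * (102 * (d + 1) ^ 2 * L)) * (εs / (1 - ϱ)))) * ((Mφ' * Mφ * Real.exp (Real.sqrt ((L : ℝ) ^ d) * (Real.sqrt (2 * d) * (102 * (d + 1) ^ 2 * L)) * (εs / (1 - ϱ)))) + 1) *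
      ((4 * (Mφ * Mφ') * (d * Real.sqrt d) + 4 * (Mφ * Mφ') * d + 2 * (Mφ * Mφ') * Real.sqrt d + Mφ' * Mφ * (Real.exp 1 * Real.exp (Real.sqrt ((L : ℝ) ^ d) * (Real.sqrt (2 * d) * (102 * (d + 1) ^ 2 * L)) * (εs / (1 - ϱ))) * (Real.sqrt ((L : ℝ) ^ d) * ((3 * 1 + (2 * d + 1) * 1) * (2 * Real.sqrt (2 * (2 * d * (102 * (d + 1) ^ 2 * L * εs) ^ 2 + 1)))))) + 1) * r * (4 / γ * (2 * (8 / γ) + (8 / γ + 4 / γ) + 2 * ((8 / γ + 4 / γ * Real.sqrt (M / Real.sqrt κ₁)) + 4 / γ) + a * (Mφ' * Mφ * Real.exp (Real.sqrt ((L : ℝ) ^ d) * (Real.sqrt (2 * d) * (102 * (d + 1) ^ 2 * L)) * (εs / (1 - ϱ)))) * (4 / γ) + a * ((Mφ' * Mφ * Real.exp (Real.sqrt ((L : ℝ) ^ d) * (Real.sqrt (2 * d) * (102 * (d + 1) ^ 2 * L)) * (εs / (1 - ϱ)))) + 1) * (4 / γ))) + (6 * ((2 * (Mφ * Mφ') *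 Real.sqrt d + 2 * M + 1) * r * (4 / γ' + M * ((4 / γ') ^ 2 * (3 + a' * (2 * M + 1))))) + 9 * ((2 * (Mφ * Mφ') * Real.sqrt d + 2 * M + 1) * r * (4 / γ' + M * ((4 / γ') ^ 2 * (3 + a' * (2 * M + 1)))))) / Real.sqrt κ₁ * ((8 / γ + 4 / γ * Real.sqrt (M / Real.sqrt κ₁)) * ((8 / γ + 4 / γ * Real.sqrt (M / Real.sqrt κ₁)) + 4 / γ)) + 8 * pK0 * r * (4 / γ) ^ 2) ≤ μ₁ / 2 := by
  have hL0 : (0 : ℝ) < L := by exact_mod_cast (lt_of_lt_of_le zero_lt_one hL)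
  have hsq : 0 < Real.sqrt κ₁ := Real.sqrt_pos.mpr hκ₁
  have hS : 0 < Real.sqrt (2 * (2 * d * (102 * (d + 1) ^ 2 * L * εs) ^ 2 + 1)) := Real.sqrt_pos.mpr (by positivity)
  have hLd : 0 < Real.sqrt ((L : ℝ) ^ d) := Real.sqrt_pos.mpr (by positivity)
  have hNB : 0 < (4 * (Mφ * Mφ') * (d * Real.sqrt d) + 4 * (Mφ * Mφ') * d + 2 * (Mφ * Mφ') * Real.sqrt d + Mφ' * Mφ * (Real.exp 1 * Real.exp (Real.sqrt ((L : ℝ) ^ d) * (Real.sqrt (2 * d) * (102 * (d + 1) ^ 2 * L)) * (εs / (1 - ϱ))) * (Real.sqrt ((L : ℝ) ^ d) * ((3 * 1 + (2 * d + 1) * 1) * (2 * Real.sqrt (2 * (2 * d * (102 * (d + 1) ^ 2 * L * εs) ^ 2 + 1)))))) + 1) := by positivity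
  have hNP : 0 < (2 * (Mφ * Mφ') * Real.sqrt d + 2 * M + 1) := by positivity
  have hX0 : 0 < (4 / γ' + M * ((4 / γ') ^ 2 * (3 + a' * (2 * M + 1)))) := by positivity
  have hCP : 0 ≤ Real.sqrt (M / Real.sqrt κ₁) := Real.sqrt_nonneg _
  have hCQ : 0 ≤ (Mφ' * Mφ * Real.exp (Real.sqrt ((L : ℝ) ^ d) * (Real.sqrt (2 * d) * (102 * (d + 1) ^ 2 * L)) * (εs / (1 - ϱ)))) := by positivity
  have hS2 : 0 < ((4 * (Mφ * Mφ') * (d * Real.sqrt d) + 4 * (Mφ * Mφ') * d + 2 * (Mφ * Mφ') * Real.sqrt d + Mφ' * Mφ * (Real.exp 1 * Real.exp (Real.sqrt ((L : ℝ) ^ d) * (Real.sqrt (2 * d) * (102 * (d + 1) ^ 2 * L)) * (εs / (1 - ϱ))) * (Real.sqrt ((L : ℝ) ^ d) * ((3 * 1 + (2 * d + 1) * 1) * (2 * Real.sqrt (2 * (2 * d * (102 * (d + 1) ^ 2 * L * εs) ^ 2 + 1)))))) + 1) * (4 / γ) * (2 * (Mφ' * Mφ * Real.exp (Real.sqrt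 ((L : ℝ) ^ d) * (Real.sqrt (2 * d) * (102 * (d + 1) ^ 2 * L)) * (εs / (1 - ϱ)))) + 1) + (Mφ' * Mφ * Real.exp (Real.sqrt ((L : ℝ) ^ d) * (Real.sqrt (2 * d) * (102 * (d + 1) ^ 2 * L)) * (εs / (1 - ϱ)))) * ((Mφ' * Mφ * Real.exp (Real.sqrt ((L : ℝ) ^ d) * (Real.sqrt (2 * d) * (102 * (d + 1) ^ 2 * L)) * (εs / (1 - ϱ)))) + 1) * ((4 * (Mφ * Mφ') * (d * Real.sqrt d) + 4 * (Mφ * Mφ') * d + 2 * (Mφ * Mφ') * Real.sqrt d + Mφ' * Mφ * (Real.exp 1 * Real.exp (Real.sqrt ((L : ℝ) ^ d) * (Real.sqrt (2 * d) * (102 * (d + 1) ^ 2 * L)) * (εs / (1 - ϱ))) * (Real.sqrt ((L : ℝ) ^ d) * ((3 * 1 + (2 * d + 1) * 1) * (2 * Real.sqrt (2 * (2 * d * (102 * (d + 1) ^ 2 * L * εs) ^ 2 + 1)))))) + 1) * (4 / γ * (2 * (8 / γ) + (8 / γ + 4 / γ) + 2 * ((8 / γ + 4 / γ * Real.sqrt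 (M / Real.sqrt κ₁)) + 4 / γ) + a * (Mφ' * Mφ * Real.exp (Real.sqrt ((L : ℝ) ^ d) * (Real.sqrt (2 * d) * (102 * (d + 1) ^ 2 * L)) * (εs / (1 - ϱ)))) * (4 / γ) + a * ((Mφ' * Mφ * Real.exp (Real.sqrt ((L : ℝ) ^ d) * (Real.sqrt (2 * d) * (102 * (d + 1) ^ 2 * L)) * (εs / (1 - ϱ)))) + 1) * (4 / γ))) + (15 * ((2 * (Mφ * Mφ') * Real.sqrt d + 2 * M + 1) * (4 / γ' + M * ((4 / γ') ^ 2 * (3 + a' * (2 * M + 1))))) / Real.sqrt κ₁) * ((8 / γ + 4 / γ * Real.sqrt (M / Real.sqrt κ₁)) * ((8 / γ + 4 / γ * Real.sqrt (M / Real.sqrt κ₁)) + 4 / γ)) + 8 * pK0 * (4 / γ) ^ 2)) := by positivity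
  rw [le_div_iff₀ hS2] at h9
  have hρ : (6 * ((2 * (Mφ * Mφ') * Real.sqrt d + 2 * M + 1) * r * (4 / γ' + M * ((4 / γ') ^ 2 * (3 + a' * (2 * M + 1))))) + 9 * ((2 * (Mφ * Mφ') * Real.sqrt d + 2 * M + 1) * r * (4 / γ' + M * ((4 / γ') ^ 2 * (3 + a' * (2 * M + 1)))))) / Real.sqrt κ₁ = (15 * ((2 * (Mφ * Mφ') * Real.sqrt d + 2 * M + 1) * (4 / γ' + M * ((4 / γ') ^ 2 * (3 + a' * (2 * M + 1))))) / Real.sqrt κ₁) * r := by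
    field_simp; ring
  rw [hρ]
  have heq : (4 * (Mφ * Mφ') * (d * Real.sqrt d) + 4 * (Mφ * Mφ') * d + 2 * (Mφ * Mφ') * Real.sqrt d + Mφ' * Mφ * (Real.exp 1 * Real.exp (Real.sqrt ((L : ℝ) ^ d) * (Real.sqrt (2 * d) * (102 * (d + 1) ^ 2 * L)) * (εs / (1 - ϱ))) * (Real.sqrt ((L : ℝ) ^ d) * ((3 * 1 + (2 * d + 1) * 1) * (2 * Real.sqrt (2 * (2 * d * (102 * (d + 1) ^ 2 * L * εs) ^ 2 + 1)))))) + 1) * r * (4 / γ) * (2 * (Mφ' * Mφ * Real.exp (Real.sqrt ((L : ℝ) ^ d) * (Real.sqrt (2 * d) * (102 * (d + 1) ^ 2 * L)) * (εs / (1 - ϱ)))) + 1) + (Mφ' * Mφ * Real.exp (Real.sqrt ((L : ℝ) ^ d) * (Real.sqrt (2 * d) * (102 * (d + 1) ^ 2 * L)) * (εs / (1 - ϱ)))) * ((Mφ' * Mφ * Real.exp (Real.sqrt ((L : ℝ) ^ d) * (Real.sqrt (2 * d) * (102 * (d + 1) ^ 2 * L)) * (εs / (1 - ϱ)))) + 1)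 *
      ((4 * (Mφ * Mφ') * (d * Real.sqrt d) + 4 * (Mφ * Mφ') * d + 2 * (Mφ * Mφ') * Real.sqrt d + Mφ' * Mφ * (Real.exp 1 * Real.exp (Real.sqrt ((L : ℝ) ^ d) * (Real.sqrt (2 * d) * (102 * (d + 1) ^ 2 * L)) * (εs / (1 - ϱ))) * (Real.sqrt ((L : ℝ) ^ d) * ((3 * 1 + (2 * d + 1) * 1) * (2 * Real.sqrt (2 * (2 * d * (102 * (d + 1) ^ 2 * L * εs) ^ 2 + 1)))))) + 1) * r * (4 / γ * (2 * (8 / γ) + (8 / γ + 4 / γ) + 2 * ((8 / γ + 4 / γ * Real.sqrt (M / Real.sqrt κ₁)) + 4 / γ) + a * (Mφ' * Mφ * Real.exp (Real.sqrt ((L : ℝ) ^ d) * (Real.sqrt (2 * d) * (102 * (d + 1) ^ 2 * L)) * (εs / (1 - ϱ)))) * (4 / γ) + a * ((Mφ' * Mφ * Real.exp (Real.sqrt ((L : ℝ) ^ d) * (Real.sqrt (2 * d) * (102 * (d + 1) ^ 2 * L)) * (εs / (1 - ϱ)))) + 1) * (4 / γ))) + (15 * ((2 * (Mφ * Mφ')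 * Real.sqrt d + 2 * M + 1) * (4 / γ' + M * ((4 / γ') ^ 2 * (3 + a' * (2 * M + 1))))) / Real.sqrt κ₁) * r * ((8 / γ + 4 / γ * Real.sqrt (M / Real.sqrt κ₁)) * ((8 / γ + 4 / γ * Real.sqrt (M / Real.sqrt κ₁)) + 4 / γ)) + 8 * pK0 * r * (4 / γ) ^ 2) = r * ((4 * (Mφ * Mφ') * (d * Real.sqrt d) + 4 * (Mφ * Mφ') * d + 2 * (Mφ * Mφ') * Real.sqrt d + Mφ' * Mφ * (Real.exp 1 * Real.exp (Real.sqrt ((L : ℝ) ^ d) * (Real.sqrt (2 * d) * (102 * (d + 1) ^ 2 * L)) * (εs / (1 - ϱ))) * (Real.sqrt ((L : ℝ) ^ d) * ((3 * 1 + (2 * d + 1) * 1) * (2 * Real.sqrt (2 * (2 * d * (102 * (d + 1) ^ 2 * L * εs) ^ 2 + 1)))))) + 1) * (4 / γ) * (2 * (Mφ' * Mφ * Real.exp (Real.sqrt ((L : ℝ) ^ d) * (Real.sqrt (2 * d) * (102 * (d + 1) ^ 2 * L)) * (εs / (1 - ϱ)))) + 1) + (Mφ' * Mφ * Real.exp (Real.sqrt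 ((L : ℝ) ^ d) * (Real.sqrt (2 * d) * (102 * (d + 1) ^ 2 * L)) * (εs / (1 - ϱ)))) * ((Mφ' * Mφ * Real.exp (Real.sqrt ((L : ℝ) ^ d) * (Real.sqrt (2 * d) * (102 * (d + 1) ^ 2 * L)) * (εs / (1 - ϱ)))) + 1) * ((4 * (Mφ * Mφ') * (d * Real.sqrt d) + 4 * (Mφ * Mφ') * d + 2 * (Mφ * Mφ') * Real.sqrt d + Mφ' * Mφ * (Real.exp 1 * Real.exp (Real.sqrt ((L : ℝ) ^ d) * (Real.sqrt (2 * d) * (102 * (d + 1) ^ 2 * L)) * (εs / (1 - ϱ))) * (Real.sqrt ((L : ℝ) ^ d) * ((3 * 1 + (2 * d + 1) * 1) * (2 * Real.sqrt (2 * (2 * d * (102 * (d + 1) ^ 2 * L * εs) ^ 2 + 1)))))) + 1) * (4 / γ * (2 * (8 / γ) + (8 / γ + 4 / γ) + 2 * ((8 / γ + 4 / γ * Real.sqrt (M / Real.sqrt κ₁)) + 4 / γ) + a * (Mφ' * Mφ * Real.exp (Real.sqrt ((L : ℝ) ^ d) * (Real.sqrt (2 * d) * (102 * (d + 1) ^ 2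 * L)) * (εs / (1 - ϱ)))) * (4 / γ) + a * ((Mφ' * Mφ * Real.exp (Real.sqrt ((L : ℝ) ^ d) * (Real.sqrt (2 * d) * (102 * (d + 1) ^ 2 * L)) * (εs / (1 - ϱ)))) + 1) * (4 / γ))) + (15 * ((2 * (Mφ * Mφ') * Real.sqrt d + 2 * M + 1) * (4 / γ' + M * ((4 / γ') ^ 2 * (3 + a' * (2 * M + 1))))) / Real.sqrt κ₁) * ((8 / γ + 4 / γ * Real.sqrt (M / Real.sqrt κ₁)) * ((8 / γ + 4 / γ * Real.sqrt (M / Real.sqrt κ₁)) + 4 / γ)) + 8 * pK0 * (4 / γ) ^ 2)) := by ring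
  rw [heq]
  exact h9

end Closing

end Literature.MathematicalPhysics.QuantumFieldTheory.Balaban1983to89.B9Eq3126ClosingRadiusWindowTower

end
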